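import Literature.MathematicalPhysics.QuantumFieldTheory.Balaban1983to89.B15Claim189ZppPin
import Literature.MathematicalPhysics.QuantumFieldTheory.Balaban1983to89.Node00.Record13Carriers

/-!
# `Balaban1983to89.B15Claim189PinsOfHistory` — YM-DAG node N12 · [Balaban1989LargeFieldI] CMP **122** (1989) 175–202, (1.89) p. 198 with (1.80), (1.82), (1.10)–(1.11),
# p. 200's `N₀`, and 𝐑′ (1.99)–(1.100) p. 201: THE N12 PIN CHAIN RE-KEYED BY THE RUN'S COUPLING HISTORY (history-generic), AND ITS STAGE-13 INSTANCE —
# the (1.100) pin at `reprTOfRecord₁₃`, the (1.89) letters `D189OfHist ν P σ g` with thresholds `ε_j = epsOfRecord ν g j` along ANY history `g`, the letters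
# `δ′_j(g)`, the numbers pin with a PER-RUN memory `N`, the term ∕ `N₀(g)` ∕ `Z″` pins, the (1.89) display theorems along `g` — every Stage-10 object of modules
# 2 ∕ 4 ∕ 7 ∕ 8 ∕ 10 ∕ 11 ∕ 12 ∕ 13 recovered at `g := gOfRecord₁₀ θ P`, `N := τ9.Nmem` BY `rfl`, and the Stage-13 objects obtained at `g := gOfRecord₁₃ θ P`

statement-level bookkeeping over published theorems with citation tags; kernel-checked compositions of tree theorems; nothing here is a claim about the Yang–Mills
mass gap.

CITATION HEADER (lean-in-tree rule).  Source: [Balaban1989LargeFieldI] («[IV]»): (1.89) p. 198, pp. 199–200 (*"From the definition of the number N₀ (recall that it is defined by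
the equation L^{−N₀+1}R_{k−N₀+1} = 1)"*), (1.80) p. 195, (1.82) p. 196, p. 183 (*"δ′_j = g_jA₁p₁(g_j)"*), (1.10)–(1.11) p. 179, p. 177 (*"in the preceding N renormalization steps
no new large field regions were created inside this component"*), p. 178 (*"h = k − N"*), p. 181 (*"k₀ = k − N₀"*), (1.99)–(1.100) p. 201; [Balaban1988Convergent] («[III]») (2.1)
p. 254, (2.4)–(2.8) pp. 255–256, (2.18) p. 257, (3.25) p. 270.  Seat `pub-ymgap-dag-n12-e` (YM-PLAN Track A, HUMAN RULING D-0062; director-ym R134 row N12 s3 «the (1.80)∕(1.89)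
+ 𝐑′ (1.99)–(1.100) p. 201 chain»), generation 5, module 14.  BY NAME and UNCHANGED: module 1 `B15RPrime1100OfRep` (`rPrimeDataOfSel`, `rPrime1100_rPrimeDataOfSel`), module 2
`B15RPrime1100AtRecord` (`ResidW.pinRPrime`), module 4 `B15Claim189PinAtRecord` (`Sit189`, `D189OfRecord`, `ResidW.pinD189`), module 5 `B15Claim189FlowAtRecord` §1
(`epsOfRecord_nonneg ∕ _pos ∕ _le ∕ _flow28a_of_inInterval`, `betaAlongHistory_le_of_betaUpperH`), module 7 `B15Claim189PinNonVacuity` (`deltaPrimeOfRecord`, `Sit189.pinChi182`,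
`chi217 ∕ chi175std ∕ chiHalf_bgOfRecord_one`, `one_mem_plaqSmall`, `chiP_pinChi182_zero`), module 8 `B15Ineq180PinAtRecord` (`dev0OfRecord`, `Sit189.pinDev0`), module 10
`B15Claim189NumericsPin` (`Sit189.pinNumerics`), module 11 `B15Claim189PrintedConditions` (`omegaOfChain`, `Sit189.pinTerm`, `sitOfTerm`, `hjEqK_of_nested`,
`claim189_assembly_printed_of_flow`), module 12 `B15Claim189N0OfRecord` (`N0OfSeq`, `N0OfRecord`, `two_le_N0OfSeq`, `RkOfRecord_le_pow_N0OfSeq`, `printCond1_of_threshold`,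
`genSeq_mono_of_beta_nonneg`, `log_pow_le_RkOfRecord`), module 13 `B15Claim189ZppPin` (`zppOfChain`, `Sit189.pinZpp`, `zppOfChain_hZk`), r11's `B15Claim189AtInstances`
(`setting189Std`, `new189_iff`, `chiH_iff`, `chiPP_iff`, `eq189_at_instances`), node00-def g30's `Node00.CarriersW` (`ResidW`), def-T's `Node00/Record13` (`Stage13Params`,
`gOfRecord₁₃`, `reprTOfRecord₁₃`), dag-n10-d's `Node00/Record13Carriers` (`WOfRecord₁₃`).

WHY THIS FILE (dag-n12-d g6 LOCATED-3, 2026-08-27, confirmed from the tree).  Every pin of the lineage is keyed on a Stage-9 parameter `θ₉` and reads the Stage-10 history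
`gOfRecord₁₀ θ₉ P` (and, for the (1.100) pin, the Stage-10 tower `repTOfRecord9 … (EOfRecord₁₀ θ₉) … (gOfRecord₁₀ θ₉ P)`).  The [IV] bundle of RECORD 13 (`WOfRecord₁₃`, the K1‴
record `StabilityBAtRecordR13e`) reads the Stage-13 history `gOfRecord₁₃ θ P = genSeq β₁₃ g₀` and tower `reprTOfRecord₁₃` — different OBJECTS (`Node00/Record13` (μ): «flow-keyed
supplies stated at a ₁₂ datum are RE-INSTANTIATED along `gOfRecord₁₃` by their (history-generic) suppliers, never transported»).  The lineage's definitions depend on `θ₉` only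
through `(θ₉.ν, θ₉.A₁, θ₉.τ9.M, θ₉.τ9.Nmem, gOfRecord₁₀ θ₉ P)`; this file re-keys them by THOSE TOKENS, with the history `g` (per run) explicit:

* §1 **`ResidW.pinRPrime₁₃ λ θ`** — the (1.100) data := module 1's `rPrimeDataOfSel` READ AT RECORD 13's pre-𝐑 tower `reprTOfRecord₁₃ θ P (kSel P)`, selector and fibres along
  `gOfRecord₁₃ θ P` (faces `rfl`; `rPrime1100 = RopReal` of that tower PROVED by module 1; dag-n12-d's displayed pin equation `hpin` at Record 13 by `rfl`).
* §2 **`D189OfHist ν P σ g`** — module 4's letters with thresholds `epsOfRecord ν g` (faces; r11's junctions `new189 ∕ chiH ∕ chiPP ∕ eq189`; the unit-configuration face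
  `new189_D189OfHist_one_iff`); `D189OfRecord θ₉ P σ = D189OfHist θ₉.ν P σ (gOfRecord₁₀ θ₉ P)` (`rfl`); **`ResidW.pinD189H λ ν g σ`** (`pinD189 = pinD189H` at ₁₀, `rfl`);
  Stage 13: **`D189OfRecord₁₃`**.
* §3 **`deltaPrimeOfHist A₁ p₁ g j = g_j A₁ (log g_j⁻²)^{p₁}`** (`deltaPrimeOfRecord = deltaPrimeOfHist` at ₁₀, `rfl`; positivity in `]0,1[` ∕ in the window); **`pinD189χH`**, **`pinD189χ₀H`**.
* §4 **`Sit189.pinLevels σ M N N₀`** — module 10's numbers pin with the memory `N` A PARAMETER (print p. 177 (ii): `N` = the number of preceding steps in which no new large field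
  region was created inside the component — a number chosen per level in print, not a constant of the record; dag-n12-d LOCATED-2 ∕ node00-def-K0a: «no constant `Nmem` serves
  every run»); `pinNumerics τ N₀ = pinLevels τ.M τ.Nmem N₀` (`rfl`); level lemmas; **`pinD189νH`** with PER-RUN `N P` and `N₀ P`.
* §5 **`sitOfHist ν A₁ M N P σ g s N₀ p₁`** (module 11's `sitOfTerm` by the tokens, `rfl` at ₁₀), **`pinD189TH`** (per-run `N`, `N₀`; `pinD189T` AND module 12's `pinD189N` are instances,
  `rfl`), **`pinD189ZH`** (module 13's `pinD189Z` an instance, `rfl`); Stage 13: **`N0OfRecord₁₃ θ P k := N0OfSeq L r (gOfRecord₁₃ θ P) k`**.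
* §6 THE (1.89) DISPLAY ALONG A HISTORY: **`claim189_sitOfHist_of_flow`** (window-free: flow inputs displayed; any `g`), **`claim189_sitOfHist_of_inInterval`** (`g = genSeq β g₀` in a
  (2.7)-small window, `β ≤ β′` along it), **`claim189_sitOfHist_N0_of_flow ∕ _of_inInterval`** (`N₀ := N0OfSeq L r g k′`: `2 ≤ N₀` and print's first p. 200 condition from
  `r ≥ 1`, one threshold on `g_{k′}` and `β ≥ 0` along the history), **`claim189_sitOfHist_N0Z_of_flow`** (`Z″` pinned: `hZk` discharged), and dag-n12-d's slot shape
  **`h189_pinD189ZH_of_h180_of_flow`**; at Record 13 these apply with `ν := θ.ν`, `A₁ := θ.A₁`, `M := θ.τ9.M`, `g := gOfRecord₁₃ F N θ P`, `β := betaOfRecord₁₃ F N θ`, `g₀ := P.g0`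
  (`gOfRecord₁₃` is that `genSeq` by definition) — **`claim189_sitOfHist₁₃_N0_of_inInterval`** records the instance.
* §8 A2: the pinned displays TESTED AT THE UNIT CONFIGURATION along any history in a window (`displays_tested_at_one_pinD189TH`).
* §9 (v1.1) the displayed window ∕ `β ≤ βup` ∕ `β ≥ 0` inputs ARE the run's DAG leaves `smallCouplings ∕ betaSmoothBounded ∕ betaPositive` at a world carrying a generated flow
  (`inInterval_genSeq_of_smallCouplings`, `betaAlongHistory_le_of_betaSmoothBounded`, `betaAlongHistory_nonneg_of_betaPositive`, any `β`); at Record 13 the datum's flow IS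
  `genFlow (betaOfRecord₁₃ θ) g₀` (`flow_datumOfRecord₁₃`, `rfl`; `flow_eq_genFlow_of_C_eq₁₃`); the sign inputs are clauses of `Stage13Params.Admissible` (`signs_of_admissible₁₃`);
  `displays_tested_at_one_pinD189TH₁₃_of_admissible`.

LOCATED (nothing asserted): (i) the per-run memory `N P` is RESIDUAL here (a parameter like `Z`, `Λ`).  Print p. 177: `N` is a number CHOSEN in the construction, per level
(*"Conditions on N will be formulated in constructions of this section"*; p. 181 uses `h = k − N ≤ k₀ = k − N₀`, i.e. `N ≥ N₀(k)`), and `Z` is then the union of the components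
that were quiet for the preceding `N` steps (condition (ii)) — so `N₀ ≤ N P` is a condition on the run's choice, not on the record's numerics (the Stage-13 witness of record keeps
`τ9.Nmem = 0`; dag-n12-d LOCATED-2 (a), node00-def-K0a: «no constant `Nmem` serves every run» — none is needed); (ii) runs with `kSel P + 1 < N₀(P)` (no component can be
`N`-quiet with `N ≥ N₀` there: print applies no 𝐑, p. 177 (ii)) stay outside these theorems (`hNk`), as located by dag-n12-d LOCATED-2 (b); (iii) the INTEGRABLE-form leaf knit
at Record 13 (`Provisos₁₃.rstep` is `ProvisosInt`) is dag-n12-d g6's `…N12LeafIntAtRecord13` — not restated here.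

HONEST FRAMING.  Count-neutral: data transformers + `rfl` dictionary + elementary real analysis over landed modules by name; nothing of Bałaban's asserted; N12 NOT discharged;
K1‴ NOT asserted; one finite four-torus programme at fixed `ε`, Bałaban AS PRINTED with locators; nothing continuum ∕ ℝ⁴ ∕ OS ∕ mass gap ∕ Clay.  No `sorry`, no `axiom`, no
`instance`, no `notation`.
-/

noncomputable section

open scoped BigOperators
open MeasureTheory

namespace Literature.MathematicalPhysics.QuantumFieldTheory.Balaban1983to89

namespace B15Claim189PinsOfHistory

open DagBinding T4Continuum Node00
open B15 (Prop1Printed Ineq180)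
open B15.BasicStep (Claim189 RopReal)
open B15.PrelimIntegrations (Ineq191 Ineq195)
open B15Chi124DetSets (E124)
open B15DeterminingSets (MSField)
open B14.Eq216Concrete (chi217 ukBox)
open B15Eq13Concrete (chiHalf chi13 oneOn)
open B15Sect1Instances (bgPPZstd chi175std chi124std)
open B15Sect1ChartInstances (bondsB0)
open B15Sect1Statements (rPrime1100)
open B15Claim189Assembly (Setting189 new189 chiH chiPP X dom domK half)
open B15Claim189AtInstances (setting189Std)
open B15Claim189PinAtRecord (D189OfRecord)
open B15Claim189PinNonVacuity (deltaPrimeOfRecord chiP_pinChi182_zero one_mem_plaqSmall chi217_bgOfRecord_one chi175std_bgOfRecord_one chiHalf_bgOfRecord_one)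
open B15Ineq180PinAtRecord (dev0OfRecord)
open B15Claim189PrintedConditions (omegaOfChain omegaOfChain_eq omegaOfChain_succ_subset omegaOfChain_top_subset sitOfTerm hjEqK_of_nested
  claim189_assembly_printed_of_flow)
open B15Claim189N0OfRecord (N0OfSeq N0OfRecord two_le_L two_le_N0OfSeq N0OfSeq_spec RkOfRecord_le_pow_N0OfSeq printCond1_of_threshold log_pow_le_RkOfRecord
  genSeq_mono_of_beta_nonneg)
open B15Claim189ZppPin (zppOfChain zppOfChain_hZk zppOfChain_top)
open B15Claim189FlowAtRecord (epsOfRecord_nonneg_of_inInterval epsOfRecord_pos_of_inInterval epsOfRecord_le_of_inInterval epsOfRecord_flow28a_of_inInterval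
  betaAlongHistory_le_of_betaUpperH)
open B15RPrime1100OfRep (rPrimeDataOfSel rPrime1100_rPrimeDataOfSel)
open B15LeafKnitRepr (WOfRepr)
open B14DomainGeom (Pt)
open B8Eq17ClassAkV1 (plaqsOf)
open GaugeGroup (dist1)
open GaugeField (plaqHol)
open FlowStep (HBeta prefixOf BetaUpperH)
open FlowStepRuns (genSeq)
open B14FlowStep (SmallnessFor)

variable {F : T4Family} {N : ℕ} [NeZero N]

/-! ## §1. The (1.100) pin AT RECORD 13 -/

section RPrime13

/-- **THE (1.100)-PINNED RESIDUAL LAYER AT RECORD 13**: `λ` with its (1.100) data REPLACED, per run, by module 1's (1.100)-reading `rPrimeDataOfSel` of the 𝐑-step of RECORD 13's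
pre-𝐑 tower `reprTOfRecord₁₃ θ P (kSel P)` with the selector of record at level `kSel P + 1` along the Stage-13 history `gOfRecord₁₃ θ P` and the fibre bonds there (exactly the
representation, selector and fibres `WOfRecord₁₃` reads); `kSel`, the (1.89) carriers ∕ letters and the Proposition-1 carrier unchanged.  Data, no law.
[cite: Balaban1989LargeFieldI, (1.100) p.201, (0.3) p.176; Balaban1988Convergent, (3.25) p.270 (objects of record)] -/
def _root_.Literature.MathematicalPhysics.QuantumFieldTheory.Balaban1983to89.Node00.ResidW.pinRPrime₁₃ (lam : ResidW F N) (θ : Stage13Params F N) : ResidW F N :=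
  { lam with
    D1100 := fun P => rPrimeDataOfSel (reprTOfRecord₁₃ F N θ P (lam.kSel P)) (θ.ppSel P (gOfRecord₁₃ F N θ P) (lam.kSel P + 1))
      (fibOfSeq F θ.ν θ.τ9 P (gOfRecord₁₃ F N θ P) (lam.kSel P + 1)) }

variable (θ : Stage13Params F N) (lam : ResidW F N)

/-- The pin keeps the step selector, the Proposition-1 carrier and the (1.89) letters (`rfl` ×3). [cite: Balaban1989LargeFieldI, (0.2) p.176, Prop. 1 p.194, (1.89) p.198 (bookkeeping)] -/
theorem pinRPrime₁₃_kSel_LF_D189 : (lam.pinRPrime₁₃ θ).kSel = lam.kSel ∧ (lam.pinRPrime₁₃ θ).LF = lam.LF ∧ (lam.pinRPrime₁₃ θ).D189 = lam.D189 := ⟨rfl, rfl, rfl⟩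

/-- **The pinned (1.100) data at run `P`** (`rfl`) — dag-n12-d's displayed pin equation `hpin` of `b15Leaf_WOfRecord₁₃_of_massSel` at the layer `λ.pinRPrime₁₃ θ`.
[cite: Balaban1989LargeFieldI, (1.100) p.201 (bookkeeping)] -/
theorem pinRPrime₁₃_D1100 (P : B12.RunParams) :
    (lam.pinRPrime₁₃ θ).D1100 P = rPrimeDataOfSel (reprTOfRecord₁₃ F N θ P (lam.kSel P)) (θ.ppSel P (gOfRecord₁₃ F N θ P) (lam.kSel P + 1))
      (fibOfSeq F θ.ν θ.τ9 P (gOfRecord₁₃ F N θ P) (lam.kSel P + 1)) := rfl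

/-- Pinning twice is pinning once (`rfl`). [cite: Balaban1989LargeFieldI, (1.100) p.201 (bookkeeping)] -/
theorem pinRPrime₁₃_pinRPrime₁₃ : (lam.pinRPrime₁₃ θ).pinRPrime₁₃ θ = lam.pinRPrime₁₃ θ := rfl

/-- **RECORD 13's [IV] bundle at the pinned layer** (`rfl`): `WOfRepr` of the Stage-13 tower with the (1.100) data THE 𝐑-STEP'S OWN READING — the shape module 1's
`b15Leaf_WOfRepr_rPrimeDataOfSel_of_mass` and dag-n12-d's integrable-form knit consume. [cite: Balaban1989LargeFieldI, (0.2) p.176, (1.100) p.201 (bookkeeping)] -/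
theorem WOfRecord₁₃_pinRPrime₁₃ (P : B12.RunParams) :
    WOfRecord₁₃ F N θ (lam.pinRPrime₁₃ θ) P =
      WOfRepr (reprTOfRecord₁₃ F N θ P (lam.kSel P)) (θ.ppSel P (gOfRecord₁₃ F N θ P) (lam.kSel P + 1)) (fibOfSeq F θ.ν θ.τ9 P (gOfRecord₁₃ F N θ P) (lam.kSel P + 1))
        (lam.LF P) (lam.D189 P)
        (rPrimeDataOfSel (reprTOfRecord₁₃ F N θ P (lam.kSel P)) (θ.ppSel P (gOfRecord₁₃ F N θ P) (lam.kSel P + 1))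
          (fibOfSeq F θ.ν θ.τ9 P (gOfRecord₁₃ F N θ P) (lam.kSel P + 1))) := rfl

/-- **`h1100` AT RECORD 13 IS A THEOREM**: 𝐑′ (1.100) of the pinned data IS the 𝐑-step (0.3) of Record 13's pre-𝐑 tower (module 1's `rPrime1100_rPrimeDataOfSel`).
[cite: Balaban1989LargeFieldI, (1.100) p.201, (0.3) p.176] -/
theorem rPrime1100_pinRPrime₁₃_D1100 (P : B12.RunParams) :
    rPrime1100 ((lam.pinRPrime₁₃ θ).D1100 P) =
      RopReal (rterm (reprTOfRecord₁₃ F N θ P (lam.kSel P))) (θ.ppSel P (gOfRecord₁₃ F N θ P) (lam.kSel P + 1))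
        (fibOfSeq F θ.ν θ.τ9 P (gOfRecord₁₃ F N θ P) (lam.kSel P + 1)) :=
  rPrime1100_rPrimeDataOfSel _ _ _

variable (F N) in
/-- **A2 — (1.100)-pinned layers EXIST at Record 13** for every parameter. [cite: Balaban1989LargeFieldI, (1.100) p.201 (bookkeeping witness)] -/
theorem exists_residW_pinRPrime₁₃ (θ : Stage13Params F N) : ∃ lam : ResidW F N, lam.pinRPrime₁₃ θ = lam :=
  let ⟨lam₀⟩ := nonempty_residW F N
  ⟨lam₀.pinRPrime₁₃ θ, rfl⟩

end RPrime13

/-! ## §2. The (1.89) letters along a history `g`, r11's junctions, the D189 pin by the tokens, the Stage-13 letters -/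

section Letters

variable (ν : Stage7Numerics) (P : B12.RunParams) (σ : Sit189 F N P.K) (g : ℕ → ℝ)

/-- **THE (1.89) LETTERS ALONG A COUPLING HISTORY `g`** at numerics `ν`, run `P`, situation `σ`: module 4's `D189OfRecord` with the thresholds `ε_j := epsOfRecord ν g j` — r11's
`setting189Std` at def-R's (2.12) solution map of record (regularity class at level `σ.k`), `M₁ := ν.M₁`, def-R's cube geometry, the fine lattice `F.P P.K`, the situation `σ`.
[cite: Balaban1989LargeFieldI, (1.89) p.198, (1.21) p.181, (1.75) p.193, (1.88) p.198; Balaban1988Convergent, (2.4) p.255, (2.12) p.256, (2.16)–(2.17) p.257 (objects of record)] -/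
def D189OfHist : Setting189 (F.P P.K) (SU N) (MSField (F.P P.K) (SU N) × ((j : ℕ) → VecField (F.P P.K) j σ.𝔤)) (Pt (F.P P.K).d) :=
  setting189Std (bgOfRecord (avOfRecord F N P.K) {U | PlaqSmall (ν.εreg * (F.P P.K).eta σ.k ^ 2) U}) ν.M₁
    (fun a => plaqInside (cubeEnl (F.P P.K) σ.sh a 1)) (fun a => cubeEnl (F.P P.K) σ.sh a 4)
    (fun a => plaqInside (cubeEnl (F.P P.K) σ.sk a 1)) (fun a => cubeEnl (F.P P.K) σ.sk a 4) σ.XΩ4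
    σ.Ω σ.Zpp σ.Z σ.Λ σ.OmT σ.ΩppT2 σ.h σ.k₀ σ.k σ.β σ.L₀ σ.α σ.δ σ.B₃ σ.B₅ σ.M σ.O1 (epsOfRecord ν g) σ.dist σ.Xhalf σ.XH σ.boxOf
    σ.chiP σ.devV'' σ.dev97 σ.dev0

/-- **MODULE 4's LETTERS OF RECORD ARE THESE AT THE STAGE-10 HISTORY** (`rfl`): nothing of the lineage changes. [cite: Balaban1989LargeFieldI, (1.89) p.198 (bookkeeping)] -/
theorem D189OfRecord_eq_D189OfHist (θ : Stage9Params F N) (P : B12.RunParams) (σ : Sit189 F N P.K) :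
    D189OfRecord θ P σ = D189OfHist θ.ν P σ (gOfRecord₁₀ F N θ P) := rfl

/-- Thresholds, `L`, `η` (`rfl` ×3). [cite: Balaban1988Convergent, (2.4) p.255; Balaban1989LargeFieldI, p.199 (bookkeeping)] -/
theorem D189OfHist_ε_L_η : (D189OfHist ν P σ g).ε = epsOfRecord ν g ∧ (D189OfHist ν P σ g).L = ((F.P P.K).L : ℝ) ∧ (D189OfHist ν P σ g).η = (F.P P.K).eta σ.k :=
  ⟨rfl, rfl, rfl⟩

/-- Levels and numbers are the situation's (`rfl`). [cite: Balaban1989LargeFieldI, (1.24) p.181, (1.80) p.195 (bookkeeping)] -/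
theorem D189OfHist_levels_numbers : (D189OfHist ν P σ g).h = σ.h ∧ (D189OfHist ν P σ g).k₀ = σ.k₀ ∧ (D189OfHist ν P σ g).k = σ.k ∧ (D189OfHist ν P σ g).M = σ.M ∧
    (D189OfHist ν P σ g).α = σ.α ∧ (D189OfHist ν P σ g).β = σ.β ∧ (D189OfHist ν P σ g).L₀ = σ.L₀ ∧ (D189OfHist ν P σ g).Ω = σ.Ω ∧
    (D189OfHist ν P σ g).Zpp = σ.Zpp := ⟨rfl, rfl, rfl, rfl, rfl, rfl, rfl, rfl, rfl⟩

/-- Its `U″_{k,Z}` IS r11's (1.21) background at def-R's solution map of record (`rfl`). [cite: Balaban1989LargeFieldI, (1.21) p.181; Balaban1988Convergent, (2.12) p.256] -/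
theorem D189OfHist_Upp (U : MSField (F.P P.K) (SU N) × ((j : ℕ) → VecField (F.P P.K) j σ.𝔤)) :
    (D189OfHist ν P σ g).Upp U = bgPPZstd (bgOfRecord (avOfRecord F N P.K) {U | PlaqSmall (ν.εreg * (F.P P.K).eta σ.k ^ 2) U}) ν.M₁ σ.Ω σ.Zpp σ.Z σ.h σ.k U.1 := rfl

/-- Its `U_{h,□}((1, V_h))` IS r11's [III] (2.16) `ukBox` at def-R's map (`rfl`). [cite: Balaban1988Convergent, (2.16) p.257; Balaban1989LargeFieldI, (1.88) p.198] -/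
theorem D189OfHist_Uhalf (U : MSField (F.P P.K) (SU N) × ((j : ℕ) → VecField (F.P P.K) j σ.𝔤)) (c : Pt (F.P P.K).d) :
    (D189OfHist ν P σ g).Uhalf U c
      = ukBox (bgOfRecord (avOfRecord F N P.K) {U | PlaqSmall (ν.εreg * (F.P P.K).eta σ.k ^ 2) U}) ν.M₁ (cubeEnl (F.P P.K) σ.sh c 4) σ.h (oneOn σ.ΩppT2 σ.h (U.1 σ.h)) := rfl

/-- **THE REMAINING FUNCTIONS OF (1.89) ALONG `g` ARE r11's CONCRETE ONES at def-R's background of record** (`σ.h ≤ σ.k`; r11's `new189_iff`).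
[cite: Balaban1989LargeFieldI, (1.89) p.198, (1.75) p.193, (1.88) p.198; Balaban1988Convergent, (2.17) p.257] -/
theorem new189_D189OfHist_iff (hhk : σ.h ≤ σ.k) (U : MSField (F.P P.K) (SU N) × ((j : ℕ) → VecField (F.P P.K) j σ.𝔤)) :
    new189 (D189OfHist ν P σ g) U ↔
      chi217 (bgOfRecord (avOfRecord F N P.K) {U | PlaqSmall (ν.εreg * (F.P P.K).eta σ.k ^ 2) U}) ν.M₁ σ.XΩ4
          (fun a => plaqInside (cubeEnl (F.P P.K) σ.sk a 1)) (fun a => cubeEnl (F.P P.K) σ.sk a 4) (epsOfRecord ν g σ.k) σ.k (U.1 σ.k) = 1 ∧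
      chi175std (bgOfRecord (avOfRecord F N P.K) {U | PlaqSmall (ν.εreg * (F.P P.K).eta σ.k ^ 2) U}) ν.M₁ σ.Z σ.Λ σ.k σ.Ω
          (epsOfRecord ν g σ.k) ((F.P P.K).eta σ.k) (U.1 σ.k) ∧
      chiHalf (bgOfRecord (avOfRecord F N P.K) {U | PlaqSmall (ν.εreg * (F.P P.K).eta σ.k ^ 2) U}) ν.M₁ σ.Xhalf
          (fun a => plaqInside (cubeEnl (F.P P.K) σ.sh a 1)) (fun a => cubeEnl (F.P P.K) σ.sh a 4) (epsOfRecord ν g) σ.h σ.ΩppT2 (U.1 σ.h) = 1 ∧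
      σ.chiP U.2 :=
  B15Claim189AtInstances.new189_iff _ _ _ _ _ _ _ _ _ _ _ _ _ _ _ _ _ _ _ _ _ _ _ _ _ _ _ _ _ _ _ _ _ hhk U

/-- The «immediate» deleted function `χ_h(Ω_h∩Z_h)` along `g` IS r11's concrete (1.3) function (`σ.h ≤ σ.k`). [cite: Balaban1989LargeFieldI, (1.89) p.198, (1.3) p.178] -/
theorem chiH_D189OfHist_iff (hhk : σ.h ≤ σ.k) (U : MSField (F.P P.K) (SU N) × ((j : ℕ) → VecField (F.P P.K) j σ.𝔤)) :
    chiH (D189OfHist ν P σ g) U ↔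
      chi13 (bgOfRecord (avOfRecord F N P.K) {U | PlaqSmall (ν.εreg * (F.P P.K).eta σ.k ^ 2) U}) ν.M₁ σ.XH
        (fun a => plaqInside (cubeEnl (F.P P.K) σ.sh a 1)) (fun a => cubeEnl (F.P P.K) σ.sh a 4) (epsOfRecord ν g) σ.h U.1 = 1 :=
  B15Claim189AtInstances.chiH_iff _ _ _ _ _ _ _ _ _ _ _ _ _ _ _ _ _ _ _ _ _ _ _ _ _ _ _ _ _ _ _ _ _ hhk U

/-- **THE DROPPED `χ″_k` ALONG `g` IS r11's CONCRETE (1.24) FUNCTION** of `U″_{k,Z}(V)` at def-R's background (`σ.h ≤ σ.k`). [cite: Balaban1989LargeFieldI, (1.89) p.198, (1.24) pp.181–182] -/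
theorem chiPP_D189OfHist_iff (hhk : σ.h ≤ σ.k) (U : MSField (F.P P.K) (SU N) × ((j : ℕ) → VecField (F.P P.K) j σ.𝔤)) :
    chiPP (D189OfHist ν P σ g) U ↔
      chi124std (bgOfRecord (avOfRecord F N P.K) {U | PlaqSmall (ν.εreg * (F.P P.K).eta σ.k ^ 2) U}) ν.M₁ σ.Ω σ.Zpp σ.Z σ.h σ.k σ.k₀ (σ.k - σ.h) σ.β σ.L₀
        (epsOfRecord ν g) ((F.P P.K).L : ℝ) ((F.P P.K).eta σ.k) U.1 :=
  B15Claim189AtInstances.chiPP_iff _ _ _ _ _ _ _ _ _ _ _ _ _ _ _ _ _ _ _ _ _ _ _ _ _ _ _ _ _ _ _ _ _ hhk U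

/-- **(1.89) AT THE OBJECTS OF RECORD ALONG `g`** (r11's `eq189_at_instances`): from `Claim189` at the letters, for a pair `(V, B′)` with the four concrete remaining functions,
r11's concrete `χ″_k` HOLDS at `V`. [cite: Balaban1989LargeFieldI, (1.89) p.198, pp.199–200] -/
theorem eq189_D189OfHist (hhk : σ.h ≤ σ.k) (h189 : Claim189 (new189 (D189OfHist ν P σ g)) (chiPP (D189OfHist ν P σ g)))
    (V : MSField (F.P P.K) (SU N)) (B' : (j : ℕ) → VecField (F.P P.K) j σ.𝔤)
    (hΩ4 : chi217 (bgOfRecord (avOfRecord F N P.K) {U | PlaqSmall (ν.εreg * (F.P P.K).eta σ.k ^ 2) U}) ν.M₁ σ.XΩ4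
      (fun a => plaqInside (cubeEnl (F.P P.K) σ.sk a 1)) (fun a => cubeEnl (F.P P.K) σ.sk a 4) (epsOfRecord ν g σ.k) σ.k (V σ.k) = 1)
    (hΛ : chi175std (bgOfRecord (avOfRecord F N P.K) {U | PlaqSmall (ν.εreg * (F.P P.K).eta σ.k ^ 2) U}) ν.M₁ σ.Z σ.Λ σ.k σ.Ω
      (epsOfRecord ν g σ.k) ((F.P P.K).eta σ.k) (V σ.k))
    (hhalf : chiHalf (bgOfRecord (avOfRecord F N P.K) {U | PlaqSmall (ν.εreg * (F.P P.K).eta σ.k ^ 2) U}) ν.M₁ σ.Xhalf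
      (fun a => plaqInside (cubeEnl (F.P P.K) σ.sh a 1)) (fun a => cubeEnl (F.P P.K) σ.sh a 4) (epsOfRecord ν g) σ.h σ.ΩppT2 (V σ.h) = 1)
    (hchi' : σ.chiP B') :
    chi124std (bgOfRecord (avOfRecord F N P.K) {U | PlaqSmall (ν.εreg * (F.P P.K).eta σ.k ^ 2) U}) ν.M₁ σ.Ω σ.Zpp σ.Z σ.h σ.k σ.k₀ (σ.k - σ.h) σ.β σ.L₀
      (epsOfRecord ν g) ((F.P P.K).L : ℝ) ((F.P P.K).eta σ.k) V :=
  B15Claim189AtInstances.eq189_at_instances _ _ _ _ _ _ _ _ _ _ _ _ _ _ _ _ _ _ _ _ _ _ _ _ _ _ _ _ _ _ _ _ _ hhk h189 V B' hΩ4 hΛ hhalf hchi'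

/-- **THE ANTECEDENT AT THE UNIT CONFIGURATION IS EXACTLY THE (1.82) LETTER** (positive thresholds `εreg`, `ε_k`, `ε_h`; `σ.h ≤ σ.k`): module 7's `new189_D189OfRecord_one_iff` along `g`.
[cite: Balaban1989LargeFieldI, (1.89) p.198, (1.82) p.196 (bookkeeping witness)] -/
theorem new189_D189OfHist_one_iff (hhk : σ.h ≤ σ.k) (hreg : 0 < ν.εreg) (hεk : 0 < epsOfRecord ν g σ.k) (hεh : 0 < epsOfRecord ν g σ.h)
    (B' : (j : ℕ) → VecField (F.P P.K) j σ.𝔤) : new189 (D189OfHist ν P σ g) ((1 : MSField (F.P P.K) (SU N)), B') ↔ σ.chiP B' := by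
  have h1 : (1 : GaugeField (F.P P.K) 0 (SU N)) ∈ {U : GaugeField (F.P P.K) 0 (SU N) | PlaqSmall (ν.εreg * (F.P P.K).eta σ.k ^ 2) U} :=
    one_mem_plaqSmall (mul_pos hreg (pow_pos (pow_pos (inv_pos.mpr (F.P P.K).cast_L_pos) σ.k) 2))
  rw [new189_D189OfHist_iff ν P σ g hhk]
  constructor
  · rintro ⟨_, _, _, hχ⟩
    exact hχ
  · intro hχ
    exact ⟨chi217_bgOfRecord_one _ h1 _ _ _ _ hεk σ.k, chi175std_bgOfRecord_one _ h1 _ _ _ σ.k _ hεk (pow_pos (inv_pos.mpr (F.P P.K).cast_L_pos) σ.k),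
      chiHalf_bgOfRecord_one _ h1 _ _ _ _ σ.h hεh _, hχ⟩

/-- **THE (1.89) LETTERS OF RECORD 13** at `(θ, P, σ)`: the letters along the Stage-13 history `gOfRecord₁₃ θ P`. [cite: Balaban1989LargeFieldI, (1.89) p.198; Balaban1987RG1, (0.17)–(0.20) pp.255–256 (objects of record)] -/
def D189OfRecord₁₃ (θ : Stage13Params F N) (P : B12.RunParams) (σ : Sit189 F N P.K) :
    Setting189 (F.P P.K) (SU N) (MSField (F.P P.K) (SU N) × ((j : ℕ) → VecField (F.P P.K) j σ.𝔤)) (Pt (F.P P.K).d) :=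
  D189OfHist θ.ν P σ (gOfRecord₁₃ F N θ P)

/-- Unfolding (`rfl`). [cite: Balaban1989LargeFieldI, (1.89) p.198 (bookkeeping)] -/
theorem D189OfRecord₁₃_eq (θ : Stage13Params F N) (P : B12.RunParams) (σ : Sit189 F N P.K) : D189OfRecord₁₃ θ P σ = D189OfHist θ.ν P σ (gOfRecord₁₃ F N θ P) := rfl

end Letters

section PinD189

/-- **THE D189-PINNED RESIDUAL LAYER BY THE TOKENS**: `λ` with, per run, the (1.89) configuration carrier := `(V, B′)` on `F.P P.K`, the cube-index carrier := `Pt (F.P P.K).d`, and the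
(1.89) letters := `D189OfHist ν P (σ P) (g P)` for a PER-RUN history `g P`; `kSel`, the Proposition-1 carrier and the (1.100) data unchanged.  Data, no law.
[cite: Balaban1989LargeFieldI, (1.89) p.198 (objects of record)] -/
def _root_.Literature.MathematicalPhysics.QuantumFieldTheory.Balaban1983to89.Node00.ResidW.pinD189H (lam : ResidW F N) (ν : Stage7Numerics)
    (g : B12.RunParams → ℕ → ℝ) (σ : ∀ P : B12.RunParams, Sit189 F N P.K) : ResidW F N :=
  { lam with
    P₀ := fun P => F.P P.K
    Cfg := fun P => MSField (F.P P.K) (SU N) × ((j : ℕ) → VecField (F.P P.K) j (σ P).𝔤)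
    ι := fun P => Pt (F.P P.K).d
    D189 := fun P => D189OfHist ν P (σ P) (g P) }

variable (lam : ResidW F N) (ν : Stage7Numerics) (g : B12.RunParams → ℕ → ℝ) (σ : ∀ P : B12.RunParams, Sit189 F N P.K)

/-- **MODULE 4's PIN IS THIS ONE AT THE STAGE-10 TOKENS** (`rfl`). [cite: Balaban1989LargeFieldI, (1.89) p.198 (bookkeeping)] -/
theorem pinD189_eq_pinD189H (θ : Stage9Params F N) : lam.pinD189 θ σ = lam.pinD189H θ.ν (gOfRecord₁₀ F N θ) σ := rfl

/-- Faces (`rfl` ×4): `kSel`, `LF`, `D1100` kept; the letters at run `P`. [cite: Balaban1989LargeFieldI, (0.2) p.176, Prop. 1 p.194, (1.89) p.198, (1.100) p.201 (bookkeeping)] -/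
theorem pinD189H_faces (P : B12.RunParams) : (lam.pinD189H ν g σ).kSel = lam.kSel ∧ (lam.pinD189H ν g σ).LF = lam.LF ∧ (lam.pinD189H ν g σ).D1100 = lam.D1100 ∧
    (lam.pinD189H ν g σ).D189 P = D189OfHist ν P (σ P) (g P) := ⟨rfl, rfl, rfl, rfl⟩

/-- The pin commutes with §1's (1.100) pin at Record 13 (`rfl`: disjoint fields). [cite: Balaban1989LargeFieldI, (1.89) p.198, (1.100) p.201 (bookkeeping)] -/
theorem pinD189H_pinRPrime₁₃_comm (θ : Stage13Params F N) : (lam.pinD189H ν g σ).pinRPrime₁₃ θ = (lam.pinRPrime₁₃ θ).pinD189H ν g σ := rfl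

/-- At Record 13 (`g := gOfRecord₁₃ θ`) the pinned letters ARE `D189OfRecord₁₃` (`rfl`). [cite: Balaban1989LargeFieldI, (1.89) p.198 (bookkeeping)] -/
theorem pinD189H_D189_record₁₃ (θ : Stage13Params F N) (P : B12.RunParams) :
    (lam.pinD189H θ.ν (gOfRecord₁₃ F N θ) σ).D189 P = D189OfRecord₁₃ θ P (σ P) := rfl

end PinD189

/-! ## §3. `δ′_j` along a history; the χ′- and dev0-pinned layers by the tokens -/

section DeltaPrime

/-- **`δ′_j` ALONG A HISTORY `g`**: p. 183 *"δ′_j = g_jA₁p₁(g_j), p₁(g_j) = (log g_j⁻²)^{p₁}"* (`p0Profile A p g = A(log g⁻²)^p`). [cite: Balaban1989LargeFieldI, (1.27) p.182, p.183] -/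
def deltaPrimeOfHist (A₁ : ℝ) (p₁ : ℕ) (g : ℕ → ℝ) (j : ℕ) : ℝ := g j * p0Profile A₁ p₁ (g j)

/-- **MODULE 7's `δ′` OF RECORD IS THIS ONE AT THE STAGE-10 HISTORY** (`rfl`). [cite: Balaban1989LargeFieldI, p.183 (bookkeeping)] -/
theorem deltaPrimeOfRecord_eq_deltaPrimeOfHist (θ : Stage9Params F N) (P : B12.RunParams) (p₁ j : ℕ) :
    deltaPrimeOfRecord F N θ P p₁ j = deltaPrimeOfHist θ.A₁ p₁ (gOfRecord₁₀ F N θ P) j := rfl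

/-- `δ′_j > 0` for a coupling in `]0, 1[` and `A₁ > 0`. [cite: Balaban1989LargeFieldI, p.183; Balaban1988Convergent, (3.4) p.265] -/
theorem deltaPrimeOfHist_pos {A₁ : ℝ} (p₁ : ℕ) {g : ℕ → ℝ} {j : ℕ} (hA₁ : 0 < A₁) (hg₀ : 0 < g j) (hg₁ : g j < 1) : 0 < deltaPrimeOfHist A₁ p₁ g j := by
  unfold deltaPrimeOfHist p0Profile
  have hsq : g j ^ 2 < 1 := by nlinarith
  have hlog : 0 < Real.log (g j ^ 2)⁻¹ := Real.log_pos ((one_lt_inv₀ (pow_pos hg₀ 2)).mpr hsq)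
  exact mul_pos hg₀ (mul_pos hA₁ (pow_pos hlog _))

/-- … in particular along a history in the window `]0, γ]`, `γ < 1`, for every `j ≤ n`. [cite: Balaban1989LargeFieldI, p.183; Balaban1987RG1, Thm 1 p.259] -/
theorem deltaPrimeOfHist_pos_of_inInterval {A₁ : ℝ} (p₁ : ℕ) {g : ℕ → ℝ} (hA₁ : 0 < A₁) {γ : ℝ} (hγ1 : γ < 1) {n : ℕ} (hI : Step.InInterval γ n g) {j : ℕ} (hj : j ≤ n) :
    0 < deltaPrimeOfHist A₁ p₁ g j :=
  deltaPrimeOfHist_pos p₁ hA₁ (hI j hj).1 ((hI j hj).2.trans_lt hγ1)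

/-- **THE χ′-PINNED LAYER BY THE TOKENS**: §2's pin at the χ′-pinned situations with `δ′_k := deltaPrimeOfHist A₁ p₁ (g P) (σ P).k`.  Data, no law.
[cite: Balaban1989LargeFieldI, (1.89) p.198, (1.82) p.196, p.183] -/
def _root_.Literature.MathematicalPhysics.QuantumFieldTheory.Balaban1983to89.Node00.ResidW.pinD189χH (lam : ResidW F N) (ν : Stage7Numerics) (A₁ : ℝ)
    (g : B12.RunParams → ℕ → ℝ) (σ : ∀ P : B12.RunParams, Sit189 F N P.K) (p₁ : ℕ) : ResidW F N :=
  lam.pinD189H ν g (fun P => (σ P).pinChi182 (deltaPrimeOfHist A₁ p₁ (g P) (σ P).k))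

/-- **… AND WITH THE (1.80) DEVIATION OF RECORD** (module 8's `Sit189.pinDev0 ν` after the χ′-pin).  Data, no law. [cite: Balaban1989LargeFieldI, (1.89) p.198, (1.80) p.195, (1.82) p.196] -/
def _root_.Literature.MathematicalPhysics.QuantumFieldTheory.Balaban1983to89.Node00.ResidW.pinD189χ₀H (lam : ResidW F N) (ν : Stage7Numerics) (A₁ : ℝ)
    (g : B12.RunParams → ℕ → ℝ) (σ : ∀ P : B12.RunParams, Sit189 F N P.K) (p₁ : ℕ) : ResidW F N :=
  lam.pinD189H ν g (fun P => ((σ P).pinChi182 (deltaPrimeOfHist A₁ p₁ (g P) (σ P).k)).pinDev0 ν)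

variable (lam : ResidW F N) (ν : Stage7Numerics) (A₁ : ℝ) (g : B12.RunParams → ℕ → ℝ) (σ : ∀ P : B12.RunParams, Sit189 F N P.K) (p₁ : ℕ)

/-- **MODULES 7 ∕ 8's PINS ARE THESE AT THE STAGE-10 TOKENS** (`rfl` ×2). [cite: Balaban1989LargeFieldI, (1.89) p.198 (bookkeeping)] -/
theorem pinD189χ_χ₀_eq_H (θ : Stage9Params F N) :
    lam.pinD189χ θ σ p₁ = lam.pinD189χH θ.ν θ.A₁ (gOfRecord₁₀ F N θ) σ p₁ ∧ lam.pinD189χ₀ θ σ p₁ = lam.pinD189χ₀H θ.ν θ.A₁ (gOfRecord₁₀ F N θ) σ p₁ := ⟨rfl, rfl⟩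

/-- The letters of the two pins at run `P` (`rfl` ×2). [cite: Balaban1989LargeFieldI, (1.89) p.198 (bookkeeping)] -/
theorem pinD189χH_χ₀H_D189 (P : B12.RunParams) :
    (lam.pinD189χH ν A₁ g σ p₁).D189 P = D189OfHist ν P ((σ P).pinChi182 (deltaPrimeOfHist A₁ p₁ (g P) (σ P).k)) (g P) ∧
    (lam.pinD189χ₀H ν A₁ g σ p₁).D189 P = D189OfHist ν P (((σ P).pinChi182 (deltaPrimeOfHist A₁ p₁ (g P) (σ P).k)).pinDev0 ν) (g P) := ⟨rfl, rfl⟩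

/-- Both keep `kSel ∕ LF ∕ D1100` and commute with §1's (1.100) pin (`rfl`). [cite: Balaban1989LargeFieldI, (0.2) p.176, (1.100) p.201 (bookkeeping)] -/
theorem pinD189χ₀H_kSel_LF_D1100_comm (θ : Stage13Params F N) : (lam.pinD189χ₀H ν A₁ g σ p₁).kSel = lam.kSel ∧ (lam.pinD189χ₀H ν A₁ g σ p₁).LF = lam.LF ∧
    (lam.pinD189χ₀H ν A₁ g σ p₁).D1100 = lam.D1100 ∧ (lam.pinD189χ₀H ν A₁ g σ p₁).pinRPrime₁₃ θ = (lam.pinRPrime₁₃ θ).pinD189χ₀H ν A₁ g σ p₁ ∧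
    (lam.pinD189χH ν A₁ g σ p₁).pinRPrime₁₃ θ = (lam.pinRPrime₁₃ θ).pinD189χH ν A₁ g σ p₁ := ⟨rfl, rfl, rfl, rfl, rfl⟩

variable {ν A₁} in
/-- **AFTER THE χ′-PIN THE (1.80)∕(1.89) BINDERS ARE CONTENTFUL ALONG ANY HISTORY IN THE WINDOW**: for a run whose history `g P` lies in `]0, γ]` up to `n` (`γ < 1`), `0 < εreg`,
`0 < A₀`, `0 < A₁`, and a situation with `σ.h ≤ σ.k ≤ n`, the pinned antecedent holds at `(V, B′) = (1, 0)`. [cite: Balaban1989LargeFieldI, (1.89) p.198, (1.82) p.196, p.183; Balaban1988Convergent, (2.4) p.255, (2.12) p.256] -/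
theorem new189_pinD189χ₀H_one_zero (hreg : 0 < ν.εreg) (hA₀ : 0 < ν.A₀) (hA₁ : 0 < A₁) {γ : ℝ} (hγ1 : γ < 1) (P : B12.RunParams) {n : ℕ}
    (hI : Step.InInterval γ n (g P)) (hhk : (σ P).h ≤ (σ P).k) (hkn : (σ P).k ≤ n) :
    new189 ((lam.pinD189χ₀H ν A₁ g σ p₁).D189 P) ((1 : MSField (F.P P.K) (SU N)), fun _ _ => (0 : EuclideanSpace ℝ (Fin (N ^ 2 - 1)))) :=
  (new189_D189OfHist_one_iff ν P (((σ P).pinChi182 (deltaPrimeOfHist A₁ p₁ (g P) (σ P).k)).pinDev0 ν) (g P) hhk hreg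
      (epsOfRecord_pos_of_inInterval ν hA₀ hγ1 hI hkn) (epsOfRecord_pos_of_inInterval ν hA₀ hγ1 hI (hhk.trans hkn)) _).2
    (chiP_pinChi182_zero (σ P) _ (deltaPrimeOfHist_pos_of_inInterval p₁ hA₁ hγ1 hI hkn))

end DeltaPrime

/-! ## §4. The numbers pin with a PER-RUN memory `N` -/

section Levels

/-- **THE (1.89) SITUATION WITH ITS NUMBERS PINNED, MEMORY A PARAMETER**: `M := M` (the basic cube size), `α := 1/12` (p. 199), `h := k − N` (p. 178; `N` = the number of preceding
steps without new large field regions inside the component, p. 177 (ii) — print's chosen number, HERE A PARAMETER, per run at the layer level), `k₀ := k − N₀` (p. 181); everything else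
unchanged.  Module 10's `pinNumerics τ N₀` is the instance `M := τ.M`, `N := τ.Nmem`.  Data, no law. [cite: Balaban1989LargeFieldI, p.177, p.178, p.181, p.199] -/
def _root_.Literature.MathematicalPhysics.QuantumFieldTheory.Balaban1983to89.Node00.Sit189.pinLevels {K : ℕ} (σ : Sit189 F N K) (M Nm N₀ : ℕ) : Sit189 F N K :=
  { σ with M := (M : ℝ), α := 1 / 12, h := σ.k - Nm, k₀ := σ.k - N₀ }

variable {K : ℕ} (σ : Sit189 F N K) (M Nm N₀ : ℕ)

/-- **MODULE 10's NUMBERS PIN IS THE INSTANCE `N := τ.Nmem`** (`rfl`). [cite: Balaban1989LargeFieldI, p.178 (bookkeeping)] -/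
theorem pinNumerics_eq_pinLevels (τ : TowerNumerics) (N₀ : ℕ) : σ.pinNumerics τ N₀ = σ.pinLevels τ.M τ.Nmem N₀ := rfl

/-- Faces (`rfl` ×5): `M`, `α = 1/12`, `h = k − N`, `k₀ = k − N₀`, `k`. [cite: Balaban1989LargeFieldI, p.178, p.181, p.199 (bookkeeping)] -/
theorem pinLevels_faces : (σ.pinLevels M Nm N₀).M = (M : ℝ) ∧ (σ.pinLevels M Nm N₀).α = 1 / 12 ∧ (σ.pinLevels M Nm N₀).h = σ.k - Nm ∧
    (σ.pinLevels M Nm N₀).k₀ = σ.k - N₀ ∧ (σ.pinLevels M Nm N₀).k = σ.k := ⟨rfl, rfl, rfl, rfl, rfl⟩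

/-- The pin keeps the chart carrier, regions, cube data, deviation letters and the residual numbers (`rfl`). [cite: Balaban1989LargeFieldI, (1.89) p.198 (bookkeeping)] -/
theorem pinLevels_kept : (σ.pinLevels M Nm N₀).𝔤 = σ.𝔤 ∧ (σ.pinLevels M Nm N₀).Ω = σ.Ω ∧ (σ.pinLevels M Nm N₀).Zpp = σ.Zpp ∧ (σ.pinLevels M Nm N₀).Z = σ.Z ∧
    (σ.pinLevels M Nm N₀).Λ = σ.Λ ∧ (σ.pinLevels M Nm N₀).OmT = σ.OmT ∧ (σ.pinLevels M Nm N₀).ΩppT2 = σ.ΩppT2 ∧ (σ.pinLevels M Nm N₀).sh = σ.sh ∧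
    (σ.pinLevels M Nm N₀).sk = σ.sk ∧ (σ.pinLevels M Nm N₀).β = σ.β ∧ (σ.pinLevels M Nm N₀).L₀ = σ.L₀ ∧ (σ.pinLevels M Nm N₀).δ = σ.δ ∧ (σ.pinLevels M Nm N₀).B₃ = σ.B₃ ∧
    (σ.pinLevels M Nm N₀).B₅ = σ.B₅ ∧ (σ.pinLevels M Nm N₀).O1 = σ.O1 ∧ (σ.pinLevels M Nm N₀).dist = σ.dist ∧ (σ.pinLevels M Nm N₀).dev0 = σ.dev0 :=
  ⟨rfl, rfl, rfl, rfl, rfl, rfl, rfl, rfl, rfl, rfl, rfl, rfl, rfl, rfl, rfl, rfl, rfl⟩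

/-- **`h ≤ k` IS AUTOMATIC** (`k − N ≤ k`). [cite: Balaban1989LargeFieldI, p.178] -/
theorem pinLevels_h_le_k : (σ.pinLevels M Nm N₀).h ≤ (σ.pinLevels M Nm N₀).k := Nat.sub_le _ _

/-- **`h ≤ k₀` ⇐ `N₀ ≤ N`** — print's condition on the AGE of the component (p. 181 «j = h + n ≦ k₀ = k − N₀»), now a condition on the run's memory, not on the record's numerics.
[cite: Balaban1989LargeFieldI, p.181, p.177] -/
theorem pinLevels_h_le_k₀ (hN : N₀ ≤ Nm) : (σ.pinLevels M Nm N₀).h ≤ (σ.pinLevels M Nm N₀).k₀ := Nat.sub_le_sub_left hN _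

/-- **`k₀ + 2 ≤ k` ⇐ `2 ≤ N₀ ≤ k`**. [cite: Balaban1989LargeFieldI, p.181, p.200] -/
theorem pinLevels_k₀_add_two_le_k (h2 : 2 ≤ N₀) (hk : N₀ ≤ σ.k) : (σ.pinLevels M Nm N₀).k₀ + 2 ≤ (σ.pinLevels M Nm N₀).k := by
  show σ.k - N₀ + 2 ≤ σ.k
  omega

/-- `0 ≤ M` and the sign input `0 ≤ O(1)B₃B₅M⁵` from `0 ≤ O(1)B₃B₅`. [cite: Balaban1989LargeFieldI, (1.80) p.195 (bookkeeping)] -/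
theorem pinLevels_M_B_nonneg (hB : 0 ≤ σ.O1 * σ.B₃ * σ.B₅) : 0 ≤ (σ.pinLevels M Nm N₀).M ∧
    0 ≤ (σ.pinLevels M Nm N₀).O1 * (σ.pinLevels M Nm N₀).B₃ * (σ.pinLevels M Nm N₀).B₅ * (σ.pinLevels M Nm N₀).M ^ 5 :=
  ⟨Nat.cast_nonneg _, mul_nonneg hB (pow_nonneg (Nat.cast_nonneg _) 5)⟩

/-- The levels pin commutes with the `dev0`, term and `Z″` pins (`rfl`). [cite: Balaban1989LargeFieldI, (1.89) p.198 (bookkeeping)] -/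
theorem pinLevels_comm (ν : Stage7Numerics) {D : ℕ → Set (Set (Site (F.P K) 0))} {k' : ℕ} (s : B14.Eq218Concrete.Seq D k') (N₀' Nm' : ℕ)
    (enl : ℕ → ℕ → Set (Site (F.P K) 0) → Set (Site (F.P K) 0)) :
    (σ.pinLevels M Nm N₀).pinDev0 ν = (σ.pinDev0 ν).pinLevels M Nm N₀ ∧ (σ.pinZpp s N₀' Nm' enl).pinLevels M Nm N₀ = (σ.pinLevels M Nm N₀).pinZpp s N₀' Nm' enl :=
  ⟨rfl, rfl⟩

/-- **THE FULLY-LETTERED PIN BY THE TOKENS WITH PER-RUN MEMORY AND `N₀`**: levels (`M`, `α`, `h = k − N P`, `k₀ = k − N₀ P`), THEN `χ′` with `δ′_k(g P)`, THEN `dev0`.  Module 10's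
`pinD189ν θ σ N₀ p₁` is the instance `M := τ9.M`, `N := τ9.Nmem`, constant `N₀`.  Data, no law. [cite: Balaban1989LargeFieldI, (1.89) p.198, (1.82) p.196, (1.80) p.195, p.178, p.181, p.199] -/
def _root_.Literature.MathematicalPhysics.QuantumFieldTheory.Balaban1983to89.Node00.ResidW.pinD189νH (lam : ResidW F N) (ν : Stage7Numerics) (A₁ : ℝ) (M : ℕ)
    (g : B12.RunParams → ℕ → ℝ) (σ : ∀ P : B12.RunParams, Sit189 F N P.K) (Nm N₀ : B12.RunParams → ℕ) (p₁ : ℕ) : ResidW F N :=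
  lam.pinD189χ₀H ν A₁ g (fun P => (σ P).pinLevels M (Nm P) (N₀ P)) p₁

/-- **MODULE 10's PIN IS THE INSTANCE** (`rfl`). [cite: Balaban1989LargeFieldI, (1.89) p.198 (bookkeeping)] -/
theorem pinD189ν_eq_H (lam : ResidW F N) (θ : Stage9Params F N) (σ : ∀ P : B12.RunParams, Sit189 F N P.K) (N₀ p₁ : ℕ) :
    lam.pinD189ν θ σ N₀ p₁ = lam.pinD189νH θ.ν θ.A₁ θ.τ9.M (gOfRecord₁₀ F N θ) σ (fun _ => θ.τ9.Nmem) (fun _ => N₀) p₁ := rfl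

/-- Its letters at run `P` and their levels (`rfl`). [cite: Balaban1989LargeFieldI, p.178, p.181 (bookkeeping)] -/
theorem pinD189νH_D189_levels (lam : ResidW F N) (ν : Stage7Numerics) (A₁ : ℝ) (M : ℕ) (g : B12.RunParams → ℕ → ℝ) (σ : ∀ P : B12.RunParams, Sit189 F N P.K)
    (Nm N₀ : B12.RunParams → ℕ) (p₁ : ℕ) (P : B12.RunParams) :
    (lam.pinD189νH ν A₁ M g σ Nm N₀ p₁).D189 P
      = D189OfHist ν P ((((σ P).pinLevels M (Nm P) (N₀ P)).pinChi182 (deltaPrimeOfHist A₁ p₁ (g P) (σ P).k)).pinDev0 ν) (g P) ∧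
    ((lam.pinD189νH ν A₁ M g σ Nm N₀ p₁).D189 P).h = (σ P).k - Nm P ∧ ((lam.pinD189νH ν A₁ M g σ Nm N₀ p₁).D189 P).k₀ = (σ P).k - N₀ P ∧
    ((lam.pinD189νH ν A₁ M g σ Nm N₀ p₁).D189 P).k = (σ P).k := ⟨rfl, rfl, rfl, rfl⟩

end Levels

/-! ## §5. The term's fully pinned situation and the term ∕ `N₀` ∕ `Z″` layers by the tokens; `N₀` of Record 13 -/

section Term

/-- **THE (1.89) SITUATION OF A TERM, FULLY PINNED, BY THE TOKENS**: top level `k := k′` and `Ω_j` := the term's (2.1)-chain (`s : SeqOfRecord F ν M g P.K k′` along the history `g`),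
THEN the numbers (`M`, `α`, `h = k′ − N`, `k₀ = k′ − N₀`), THEN `χ′` with `δ′_{k′}(g)`, THEN the (1.80) deviation at level `k′`.  Module 11's `sitOfTerm θ₉ P σ s N₀ p₁` is the instance
`ν := θ₉.ν`, `A₁ := θ₉.A₁`, `M := τ9.M`, `N := τ9.Nmem`, `g := gOfRecord₁₀ θ₉ P`.  Data, no law.
[cite: Balaban1989LargeFieldI, (1.89) p.198, p.177, (1.2) p.178, p.181, (1.80) p.195, (1.82) p.196, p.199; Balaban1988Convergent, (2.1) p.254, (2.18) p.257] -/
def sitOfHist (ν : Stage7Numerics) (A₁ : ℝ) (M Nm : ℕ) (P : B12.RunParams) (σ : Sit189 F N P.K) (g : ℕ → ℝ) {k' : ℕ}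
    (s : SeqOfRecord F ν M g P.K k') (N₀ p₁ : ℕ) : Sit189 F N P.K :=
  (((σ.pinTerm s).pinLevels M Nm N₀).pinChi182 (deltaPrimeOfHist A₁ p₁ g k')).pinDev0 ν

/-- **MODULE 11's `sitOfTerm` IS THE INSTANCE** (`rfl`). [cite: Balaban1989LargeFieldI, (1.89) p.198 (bookkeeping)] -/
theorem sitOfTerm_eq_sitOfHist (θ : Stage9Params F N) (P : B12.RunParams) (σ : Sit189 F N P.K) {k' : ℕ}
    (s : SeqOfRecord F θ.ν θ.τ9.M (gOfRecord₁₀ F N θ P) P.K k') (N₀ p₁ : ℕ) :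
    sitOfTerm θ P σ s N₀ p₁ = sitOfHist θ.ν θ.A₁ θ.τ9.M θ.τ9.Nmem P σ (gOfRecord₁₀ F N θ P) s N₀ p₁ := rfl

variable (ν : Stage7Numerics) (A₁ : ℝ) (M Nm : ℕ) (P : B12.RunParams) (σ : Sit189 F N P.K) (g : ℕ → ℝ) {k' : ℕ} (s : SeqOfRecord F ν M g P.K k') (N₀ p₁ : ℕ)

/-- Its regions: `Ω_j` = the term's clamped chain (the term's own `Ω_j` on `1 ≤ j ≤ k′`); `Z″, Z, Λ, Ω″`-regions the situation's (`rfl`). [cite: Balaban1988Convergent, (2.1) p.254; Balaban1989LargeFieldI, (1.2) p.178 (bookkeeping)] -/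
theorem sitOfHist_regions : (sitOfHist ν A₁ M Nm P σ g s N₀ p₁).Ω = omegaOfChain s ∧ (sitOfHist ν A₁ M Nm P σ g s N₀ p₁).Zpp = σ.Zpp ∧ (sitOfHist ν A₁ M Nm P σ g s N₀ p₁).Z = σ.Z ∧
    (sitOfHist ν A₁ M Nm P σ g s N₀ p₁).Λ = σ.Λ ∧ (sitOfHist ν A₁ M Nm P σ g s N₀ p₁).OmT = σ.OmT ∧ (sitOfHist ν A₁ M Nm P σ g s N₀ p₁).ΩppT2 = σ.ΩppT2 :=
  ⟨rfl, rfl, rfl, rfl, rfl, rfl⟩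

/-- On the window its `Ω_j` IS the term's `Ω_j`. [cite: Balaban1988Convergent, (2.1) p.254] -/
theorem sitOfHist_Ω_eq {j : ℕ} (h1 : 1 ≤ j) (hj : j ≤ k') : (sitOfHist ν A₁ M Nm P σ g s N₀ p₁).Ω j = s.Ω j := omegaOfChain_eq s h1 hj

/-- Its levels and numbers: `h = k′ − N`, `k₀ = k′ − N₀`, `k = k′`, `M`, `α = 1/12`; `β, L₀, δ, B₃, B₅, O(1)`, `dist` the situation's (`rfl`). [cite: Balaban1989LargeFieldI, p.178, p.181, p.199 (bookkeeping)] -/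
theorem sitOfHist_levels_numbers : (sitOfHist ν A₁ M Nm P σ g s N₀ p₁).h = k' - Nm ∧ (sitOfHist ν A₁ M Nm P σ g s N₀ p₁).k₀ = k' - N₀ ∧ (sitOfHist ν A₁ M Nm P σ g s N₀ p₁).k = k' ∧
    (sitOfHist ν A₁ M Nm P σ g s N₀ p₁).M = (M : ℝ) ∧ (sitOfHist ν A₁ M Nm P σ g s N₀ p₁).α = 1 / 12 ∧ (sitOfHist ν A₁ M Nm P σ g s N₀ p₁).β = σ.β ∧
    (sitOfHist ν A₁ M Nm P σ g s N₀ p₁).L₀ = σ.L₀ ∧ (sitOfHist ν A₁ M Nm P σ g s N₀ p₁).δ = σ.δ ∧ (sitOfHist ν A₁ M Nm P σ g s N₀ p₁).B₃ = σ.B₃ ∧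
    (sitOfHist ν A₁ M Nm P σ g s N₀ p₁).B₅ = σ.B₅ ∧ (sitOfHist ν A₁ M Nm P σ g s N₀ p₁).O1 = σ.O1 ∧ (sitOfHist ν A₁ M Nm P σ g s N₀ p₁).dist = σ.dist :=
  ⟨rfl, rfl, rfl, rfl, rfl, rfl, rfl, rfl, rfl, rfl, rfl, rfl⟩

/-- Its (1.80) letter is `|U_{k′,Z}(V_Λ)(∂q) − 1|` of record at level `k′`, its chart carrier is `ℝ^{N²−1}`, its cube data and the two other deviation letters are the situation's (`rfl`).
[cite: Balaban1989LargeFieldI, (1.79)–(1.80) p.195, (1.82) p.196, (1.88)–(1.90) pp.197–198 (bookkeeping)] -/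
theorem sitOfHist_dev0_cubes : (sitOfHist ν A₁ M Nm P σ g s N₀ p₁).dev0 = dev0OfRecord F N ν P.K σ.Z σ.Λ k' ∧ (sitOfHist ν A₁ M Nm P σ g s N₀ p₁).𝔤 = EuclideanSpace ℝ (Fin (N ^ 2 - 1)) ∧
    (sitOfHist ν A₁ M Nm P σ g s N₀ p₁).sh = σ.sh ∧ (sitOfHist ν A₁ M Nm P σ g s N₀ p₁).sk = σ.sk ∧ (sitOfHist ν A₁ M Nm P σ g s N₀ p₁).Xhalf = σ.Xhalf ∧
    (sitOfHist ν A₁ M Nm P σ g s N₀ p₁).XH = σ.XH ∧ (sitOfHist ν A₁ M Nm P σ g s N₀ p₁).XΩ4 = σ.XΩ4 ∧ (sitOfHist ν A₁ M Nm P σ g s N₀ p₁).boxOf = σ.boxOf ∧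
    (sitOfHist ν A₁ M Nm P σ g s N₀ p₁).devV'' = σ.devV'' ∧ (sitOfHist ν A₁ M Nm P σ g s N₀ p₁).dev97 = σ.dev97 := ⟨rfl, rfl, rfl, rfl, rfl, rfl, rfl, rfl, rfl, rfl⟩

/-- Its (1.82) function: `|B′(b)| < δ′_{k′}(g)` on the bonds of `𝔹₀` built with the PINNED regions and levels (`Iff.rfl`). [cite: Balaban1989LargeFieldI, (1.82) p.196, p.183] -/
theorem sitOfHist_chiP_iff (B' : (j : ℕ) → VecField (F.P P.K) j (EuclideanSpace ℝ (Fin (N ^ 2 - 1)))) :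
    (sitOfHist ν A₁ M Nm P σ g s N₀ p₁).chiP B' ↔ ∀ j, ∀ b ∈ bondsB0 (omegaOfChain s) σ.Zpp σ.Z σ.Λ σ.ΩppT2 (k' - Nm) k' j, ‖B' j b‖ < deltaPrimeOfHist A₁ p₁ g k' := Iff.rfl

/-- **THE TERM-PINNED RESIDUAL LAYER BY THE TOKENS, PER-RUN MEMORY `N P` AND `N₀ P`**: §2's pin at the terms' fully pinned situations (per run ONE term `s P` of top index `kSel P + 1`
along the run's history `g P`).  Module 11's `pinD189T` (constant `N₀`, `N := τ9.Nmem`) AND module 12's `pinD189N` (`N₀ P := N0OfRecord θ P (kSel P + 1)`) are instances.  Data, no law.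
[cite: Balaban1989LargeFieldI, (1.89) p.198, p.177, (1.2) p.178, p.181, p.200; Balaban1988Convergent, (2.1) p.254, (2.18) p.257] -/
def _root_.Literature.MathematicalPhysics.QuantumFieldTheory.Balaban1983to89.Node00.ResidW.pinD189TH (lam : ResidW F N) (ν : Stage7Numerics) (A₁ : ℝ) (M : ℕ)
    (g : B12.RunParams → ℕ → ℝ) (σ : ∀ P : B12.RunParams, Sit189 F N P.K) (s : ∀ P : B12.RunParams, SeqOfRecord F ν M (g P) P.K (lam.kSel P + 1))
    (Nm N₀ : B12.RunParams → ℕ) (p₁ : ℕ) : ResidW F N :=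
  lam.pinD189H ν g (fun P => sitOfHist ν A₁ M (Nm P) P (σ P) (g P) (s P) (N₀ P) p₁)

/-- **… AND WITH PRINT'S `Z″_j` PINNED TO THE TERM'S CHAIN** (module 13's `Sit189.pinZpp` at memories `N₀ P ≤ N P`, enlargement letter `enl P`).  Module 13's `pinD189Z` is the instance.
Data, no law. [cite: Balaban1989LargeFieldI, (1.89) p.198, (1.10)–(1.11) p.179, p.200] -/
def _root_.Literature.MathematicalPhysics.QuantumFieldTheory.Balaban1983to89.Node00.ResidW.pinD189ZH (lam : ResidW F N) (ν : Stage7Numerics) (A₁ : ℝ) (M : ℕ)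
    (g : B12.RunParams → ℕ → ℝ) (σ : ∀ P : B12.RunParams, Sit189 F N P.K) (s : ∀ P : B12.RunParams, SeqOfRecord F ν M (g P) P.K (lam.kSel P + 1))
    (Nm N₀ : B12.RunParams → ℕ) (enl : ∀ P : B12.RunParams, ℕ → ℕ → Set (Site (F.P P.K) 0) → Set (Site (F.P P.K) 0)) (p₁ : ℕ) : ResidW F N :=
  lam.pinD189TH ν A₁ M g (fun P => (σ P).pinZpp (s P) (N₀ P) (Nm P) (enl P)) s Nm N₀ p₁

/-- **MODULES 11 ∕ 12 ∕ 13's LAYERS ARE THE INSTANCES AT THE STAGE-10 TOKENS** (`rfl` ×3): `pinD189T` (constant `N₀`), `pinD189N` (`N₀` of record per run), `pinD189Z`.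
[cite: Balaban1989LargeFieldI, (1.89) p.198 (bookkeeping)] -/
theorem pinD189T_N_Z_eq_H (θ : Stage9Params F N) (lam : ResidW F N) (σT : ∀ P : B12.RunParams, Sit189 F N P.K)
    (sT : ∀ P : B12.RunParams, SeqOfRecord F θ.ν θ.τ9.M (gOfRecord₁₀ F N θ P) P.K (lam.kSel P + 1))
    (enl : ∀ P : B12.RunParams, ℕ → ℕ → Set (Site (F.P P.K) 0) → Set (Site (F.P P.K) 0)) (N₀ p₁ : ℕ) :
    lam.pinD189T θ σT sT N₀ p₁ = lam.pinD189TH θ.ν θ.A₁ θ.τ9.M (gOfRecord₁₀ F N θ) σT sT (fun _ => θ.τ9.Nmem) (fun _ => N₀) p₁ ∧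
    lam.pinD189N θ σT sT p₁ = lam.pinD189TH θ.ν θ.A₁ θ.τ9.M (gOfRecord₁₀ F N θ) σT sT (fun _ => θ.τ9.Nmem) (fun P => N0OfRecord θ P (lam.kSel P + 1)) p₁ ∧
    lam.pinD189Z θ σT sT enl p₁ =
      lam.pinD189ZH θ.ν θ.A₁ θ.τ9.M (gOfRecord₁₀ F N θ) σT sT (fun _ => θ.τ9.Nmem) (fun P => N0OfRecord θ P (lam.kSel P + 1)) enl p₁ := ⟨rfl, rfl, rfl⟩

variable (lam : ResidW F N) (gT : B12.RunParams → ℕ → ℝ) (σT : ∀ P : B12.RunParams, Sit189 F N P.K)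
  (sT : ∀ P : B12.RunParams, SeqOfRecord F ν M (gT P) P.K (lam.kSel P + 1)) (NmT N₀T : B12.RunParams → ℕ)
  (enl : ∀ P : B12.RunParams, ℕ → ℕ → Set (Site (F.P P.K) 0) → Set (Site (F.P P.K) 0))

/-- The letters of the two layers at run `P` (`rfl` ×2). [cite: Balaban1989LargeFieldI, (1.89) p.198 (bookkeeping)] -/
theorem pinD189TH_ZH_D189 (P : B12.RunParams) :
    (lam.pinD189TH ν A₁ M gT σT sT NmT N₀T p₁).D189 P = D189OfHist ν P (sitOfHist ν A₁ M (NmT P) P (σT P) (gT P) (sT P) (N₀T P) p₁) (gT P) ∧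
    (lam.pinD189ZH ν A₁ M gT σT sT NmT N₀T enl p₁).D189 P =
      D189OfHist ν P (sitOfHist ν A₁ M (NmT P) P ((σT P).pinZpp (sT P) (N₀T P) (NmT P) (enl P)) (gT P) (sT P) (N₀T P) p₁) (gT P) := ⟨rfl, rfl⟩

/-- **THE LEVEL PIN**: top `k = kSel P + 1`, bottom `h = kSel P + 1 − N P`, middle `k₀ = kSel P + 1 − N₀ P` (`rfl`, both layers); `kSel ∕ LF ∕ D1100` kept, and both commute with §1's
(1.100) pin at Record 13 (`rfl`). [cite: Balaban1989LargeFieldI, p.177, p.178, p.181, (1.100) p.201 (bookkeeping)] -/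
theorem pinD189TH_ZH_levels_comm (θ : Stage13Params F N) (P : B12.RunParams) :
    ((lam.pinD189TH ν A₁ M gT σT sT NmT N₀T p₁).D189 P).k = lam.kSel P + 1 ∧ ((lam.pinD189TH ν A₁ M gT σT sT NmT N₀T p₁).D189 P).h = lam.kSel P + 1 - NmT P ∧
    ((lam.pinD189TH ν A₁ M gT σT sT NmT N₀T p₁).D189 P).k₀ = lam.kSel P + 1 - N₀T P ∧
    ((lam.pinD189ZH ν A₁ M gT σT sT NmT N₀T enl p₁).D189 P).h = lam.kSel P + 1 - NmT P ∧
    (lam.pinD189TH ν A₁ M gT σT sT NmT N₀T p₁).kSel = lam.kSel ∧ (lam.pinD189TH ν A₁ M gT σT sT NmT N₀T p₁).LF = lam.LF ∧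
    (lam.pinD189TH ν A₁ M gT σT sT NmT N₀T p₁).D1100 = lam.D1100 ∧ (lam.pinD189ZH ν A₁ M gT σT sT NmT N₀T enl p₁).D1100 = lam.D1100 ∧
    (lam.pinD189TH ν A₁ M gT σT sT NmT N₀T p₁).pinRPrime₁₃ θ = (lam.pinRPrime₁₃ θ).pinD189TH ν A₁ M gT σT sT NmT N₀T p₁ ∧
    (lam.pinD189ZH ν A₁ M gT σT sT NmT N₀T enl p₁).pinRPrime₁₃ θ = (lam.pinRPrime₁₃ θ).pinD189ZH ν A₁ M gT σT sT NmT N₀T enl p₁ :=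
  ⟨rfl, rfl, rfl, rfl, rfl, rfl, rfl, rfl, rfl, rfl⟩

/-- The `Z″`-layer's top new large-field region at run `P`: `Z″_k = (Ω^{∼5}_{k₀+1})ᶜ ∩ Z` at `k = kSel P + 1` (for `2 ≤ N₀ P ≤ N P`). [cite: Balaban1989LargeFieldI, (1.10) p.179] -/
theorem pinD189ZH_Zpp_top (P : B12.RunParams) (hN2 : 2 ≤ N₀T P) (hNN : N₀T P ≤ NmT P) :
    ((lam.pinD189ZH ν A₁ M gT σT sT NmT N₀T enl p₁).D189 P).Zpp (lam.kSel P + 1) =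
      (enl P 5 (lam.kSel P + 1 + 1 - N₀T P) (omegaOfChain (sT P) (lam.kSel P + 1 + 1 - N₀T P)))ᶜ ∩ (σT P).Z :=
  zppOfChain_top (sT P) _ _ _ _ _ hN2 hNN

/-- **`N₀` OF RECORD 13** at run `P` and level `k`: print's number (p. 200, `L^{−N₀+1}R_{k−N₀+1} = 1` read at its first solution, module 12's `N0OfSeq`) for the Stage-13 history
`gOfRecord₁₃ θ P` and the record's `L`, `r`.  Module 12's `N0OfRecord θ₉ P k` is `N0OfSeq L r (gOfRecord₁₀ θ₉ P) k` (`rfl`). [cite: Balaban1989LargeFieldI, p.200, p.181] -/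
def N0OfRecord₁₃ (θ : Stage13Params F N) (P : B12.RunParams) (k : ℕ) : ℕ :=
  N0OfSeq (F.P P.K).L θ.ν.r (gOfRecord₁₃ F N θ P) k

/-- Unfolding, and module 12's Stage-10 instance (`rfl` ×2). [cite: Balaban1989LargeFieldI, p.200 (bookkeeping)] -/
theorem N0OfRecord₁₃_eq (θ : Stage13Params F N) (P : B12.RunParams) (k : ℕ) : N0OfRecord₁₃ θ P k = N0OfSeq (F.P P.K).L θ.ν.r (gOfRecord₁₃ F N θ P) k ∧
    N0OfRecord θ.toStage9Params P k = N0OfSeq (F.P P.K).L θ.ν.r (gOfRecord₁₀ F N θ.toStage9Params P) k := ⟨rfl, rfl⟩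

end Term

section N0Hist

variable (ν : Stage7Numerics) (P : B12.RunParams) (g : ℕ → ℝ)

/-- **`2 ≤ N₀`** of a history from its level-`k` coupling: `1 < (log g_k⁻²)^r` (module 12's `two_le_N0OfSeq` at the record's `L ≥ 2`). [cite: Balaban1989LargeFieldI, p.200, p.181] -/
theorem two_le_N0OfSeq_of_hist {k : ℕ} (hg : 1 < (Real.log (g k ^ 2)⁻¹) ^ ν.r) : 2 ≤ N0OfSeq (F.P P.K).L ν.r g k :=
  two_le_N0OfSeq ν.r g k (two_le_L (F := F) P) hg

variable {P g} in
/-- **IN A (2.7)-SMALL WINDOW THE TOP COUPLING PASSES `1 < (log g_k⁻²)^r`** (`r ≥ 1`; module 12's argument along any history). [cite: Balaban1988Convergent, (2.5) p.255, (2.7) p.255] -/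
theorem one_lt_log_pow_of_inInterval_hist {γ β' β₀ : ℝ} {L p : ℕ} (S : SmallnessFor γ β' β₀ L p) {k : ℕ} (hI : Step.InInterval γ k g) (hr : 1 ≤ ν.r) :
    1 < (Real.log (g k ^ 2)⁻¹) ^ ν.r := by
  obtain ⟨hg0, hgγ⟩ := hI k le_rfl
  have hγ0 : 0 < γ := S.γ_pos
  have hp : (0 : ℝ) ≤ p := Nat.cast_nonneg _
  have h2 : 2 ≤ Real.log (γ ^ 2)⁻¹ := by have := S.h27a; linarith
  have hmono : Real.log (γ ^ 2)⁻¹ ≤ Real.log (g k ^ 2)⁻¹ := Real.log_le_log (by positivity) (inv_anti₀ (by positivity) (by nlinarith))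
  have hge : (2 : ℝ) ≤ Real.log (g k ^ 2)⁻¹ := h2.trans hmono
  calc (1 : ℝ) < 2 := one_lt_two
    _ = 2 ^ 1 := (pow_one _).symm
    _ ≤ 2 ^ ν.r := pow_le_pow_right₀ one_le_two hr
    _ ≤ (Real.log (g k ^ 2)⁻¹) ^ ν.r := pow_le_pow_left₀ (by norm_num) hge _

/-- **PRINT'S FIRST p. 200 CONDITION ALONG A GENERATED HISTORY IS A THEOREM OF ONE THRESHOLD** (module 12's `printCond1_N0OfRecord_of_threshold` by the tokens): for `g = genSeq β g₀` in
`]0, γ]` up to `k` (`γ ≤ 1`) with `β ≥ 0` along it below `k` and `1 < L₀`, `4(2 + C) ≤ ((log g_k⁻²)^r)^{α₀}` gives `(2 + C)((L₀²)^{N₀−1})⁻¹ ≤ 1/4` at `N₀ := N0OfSeq L r g k`.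
[cite: Balaban1989LargeFieldI, p.200; Balaban1988Convergent, (2.5)–(2.6) p.255; Balaban1987RG1, (0.20) p.256] -/
theorem printCond1_N0OfSeq_of_threshold (β : HBeta) {γ L₀ C : ℝ} {k : ℕ} (hγ1 : γ ≤ 1) (hI : Step.InInterval γ k (genSeq β P.g0))
    (hβ0 : ∀ j, j < k → 0 ≤ β j (prefixOf (genSeq β P.g0) j)) (hL₀ : 1 < L₀)
    (hwin : 4 * (2 + C) ≤ ((Real.log (genSeq β P.g0 k ^ 2)⁻¹) ^ ν.r) ^ (Real.log (L₀ ^ 2) / Real.log ((F.P P.K).L : ℝ))) :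
    (2 + C) * ((L₀ ^ 2) ^ (N0OfSeq (F.P P.K).L ν.r (genSeq β P.g0) k - 1))⁻¹ ≤ 1 / 4 := by
  have hN1 : 1 ≤ N0OfSeq (F.P P.K).L ν.r (genSeq β P.g0) k := (N0OfSeq_spec ν.r (genSeq β P.g0) k (two_le_L (F := F) P)).1
  have hpos : ∀ i, i ≤ k → 0 < genSeq β P.g0 i := fun i hi => (hI i hi).1
  have hmono : genSeq β P.g0 (k + 1 - N0OfSeq (F.P P.K).L ν.r (genSeq β P.g0) k) ≤ genSeq β P.g0 k :=
    genSeq_mono_of_beta_nonneg β P.g0 hpos hβ0 (by omega) le_rfl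
  have hle : genSeq β P.g0 k ≤ 1 := (hI k le_rfl).2.trans hγ1
  have hRk := RkOfRecord_le_pow_N0OfSeq ν.r (genSeq β P.g0) k (two_le_L P) (hpos _ (by omega)) hmono hle
  have hX0 : 0 ≤ (Real.log (genSeq β P.g0 k ^ 2)⁻¹) ^ ν.r := by
    apply pow_nonneg
    apply Real.log_nonneg
    have hg := hpos k le_rfl
    exact one_le_inv_iff₀.mpr ⟨by positivity, by nlinarith⟩
  exact printCond1_of_threshold (two_le_L P) hL₀ hRk hX0 (log_pow_le_RkOfRecord (two_le_L P) ν.r _) hwin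

end N0Hist

/-! ## §6. The (1.89) display along a history — window-free (`_of_flow`) and window (`_of_inInterval`) forms; `N₀` of the history; `Z″` pinned; dag-n12-d's slot shape -/

section Display

variable {ν : Stage7Numerics} {A₁ : ℝ} {M : ℕ} (Nm : ℕ) (P : B12.RunParams) (σ : Sit189 F N P.K) {g : ℕ → ℝ} {k' : ℕ} (s : SeqOfRecord F ν M g P.K k') (N₀ p₁ : ℕ)

/-- **(1.89) AT THE TERM'S FULLY PINNED LETTERS ALONG ANY HISTORY — WINDOW-FREE FORM** (module 11's `claim189_sitOfTerm_of_flow` by the tokens, memory `N` a parameter).  For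
`D = D189OfHist ν P (sitOfHist ν A₁ M N P σ g s N₀ p₁) g` (`hD`; instantiate `rfl`): `Claim189 (new189 D) (chiPP D)` FROM — levels `2 ≤ N₀ ≤ N`, `N₀ ≤ k′`; residual numerics
`0 ≤ β ≤ 1/4`, `2 ≤ L₀`, `L₀² ≤ L`, signs; print's two p. 200 conditions; the flow inputs DISPLAYED (`0 ≤ ε_i ≤ 1/10` on `k′ − N ≤ i ≤ k′`, (2.8) with `0 ≤ β₀ ≤ ½`) at `ε_j = epsOfRecord ν g j`;
the located geometry (`Z″_{k′} ∩ Ω_m ⊆ Ω_{m+1}`, shell bound, (1.88) cover); the four ℍ-leaves; (1.80).  DISCHARGED by name: `hhk ∕ hk₀` (§4), `hα` (`rfl`), `hM`, `hΩ ∕ hΩtop` ((2.1)),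
`hX' ∕ hsmall ∕ hlarge ∕ hjEqK` (module 11 §1). [cite: Balaban1989LargeFieldI, (1.89) p.198, pp.199–200, (1.80) p.195; Balaban1988Convergent, (2.1) p.254, (2.8) p.256] -/
theorem claim189_sitOfHist_of_flow
    {D : Setting189 (F.P P.K) (SU N) (MSField (F.P P.K) (SU N) × ((j : ℕ) → VecField (F.P P.K) j (EuclideanSpace ℝ (Fin (N ^ 2 - 1))))) (Pt (F.P P.K).d)}
    (hD : D = D189OfHist ν P (sitOfHist ν A₁ M Nm P σ g s N₀ p₁) g)
    (hN2 : 2 ≤ N₀) (hNN : N₀ ≤ Nm) (hNk : N₀ ≤ k')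
    (hβ0 : 0 ≤ σ.β) (hβ : σ.β ≤ 1 / 4) (hL₀ : 2 ≤ σ.L₀) (hL₀L : σ.L₀ ^ 2 ≤ ((F.P P.K).L : ℝ))
    (hB : 0 ≤ σ.O1 * σ.B₃ * σ.B₅) (hδ : 0 ≤ σ.δ) (hdist : ∀ p, 0 ≤ σ.dist p)
    (hN₀ : (2 + (121 / 120) ^ 2 * (σ.O1 * σ.B₃ * σ.B₅ * (M : ℝ) ^ 5)) * ((σ.L₀ ^ 2) ^ (N₀ - 1))⁻¹ ≤ 1 / 4)
    (hMl : (121 / 120) ^ 2 * (σ.O1 * σ.B₃ * σ.B₅ * (M : ℝ) ^ 5) * Real.exp (-(4 * σ.δ * (M : ℝ))) ≤ 1 / 12)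
    (hε0 : ∀ i, k' - Nm ≤ i → i ≤ k' → 0 ≤ epsOfRecord ν g i) (hε1 : ∀ i, k' - Nm ≤ i → i ≤ k' → epsOfRecord ν g i ≤ 1 / 10)
    {β₀ : ℝ} (hβ₀0 : 0 ≤ β₀) (hβ₀ : β₀ ≤ 1 / 2)
    (hflow : ∀ j, k' - Nm ≤ j → j < k' → epsOfRecord ν g k' ≤ (1 + β₀) * Real.sqrt ((k' - j : ℕ) : ℝ) * epsOfRecord ν g j)
    (hZk : ∀ m, k' - N₀ < m → m < k' → σ.Zpp k' ∩ omegaOfChain s m ⊆ omegaOfChain s (m + 1))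
    (hgeom : ∀ m, D.k₀ < m → m < D.k → ∀ p ∈ plaqsOf (D.Ω m \ D.Ω (m + 1)), 4 * ((m : ℝ) - D.k₀) * D.M ≤ D.dist p)
    (hbox : ∀ p ∈ plaqsOf (half D), D.boxOf p ∈ D.halfcubes ∧ p ∈ D.plaqT (D.boxOf p))
    (L91h : ∀ U, new189 D U → ∀ p ∈ plaqsOf (half D),
      Ineq191 (dist1 (plaqHol (D.Upp U) p)) (D.devV'' U p) D.α ((D.L ^ D.h)⁻¹) (D.ε D.h) (E124 D.ε D.L D.η D.k D.h))
    (L95 : ∀ U, new189 D U → ∀ p ∈ plaqsOf (half D),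
      Ineq195 (D.devV'' U p) (dist1 (plaqHol (D.Uhalf U (D.boxOf p)) p)) D.α ((D.L ^ D.h)⁻¹) (D.ε D.h) (E124 D.ε D.L D.η D.k D.h))
    (L91 : ∀ U, new189 D U → ∀ j, D.h ≤ j → j ≤ D.k → ∀ p ∈ plaqsOf (dom D j),
      Ineq191 (dist1 (plaqHol (D.Upp U) p)) (D.dev97 U p) D.α ((D.L ^ j)⁻¹) (D.ε j) (E124 D.ε D.L D.η D.k j))
    (L97 : ∀ U, new189 D U → ∀ j, D.h ≤ j → j ≤ D.k → ∀ p ∈ plaqsOf (dom D j),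
      Ineq191 (D.dev97 U p) (D.dev0 U p) D.α ((D.L ^ j)⁻¹) (D.ε j) (E124 D.ε D.L D.η D.k j))
    (L80 : ∀ U, new189 D U → ∀ j, D.h ≤ j → j ≤ D.k → ∀ p ∈ plaqsOf (dom D j),
      Ineq180 (D.dev0 U p) (D.ε D.k) D.η D.B₃ D.B₅ D.M D.δ (D.dist p) D.O1) :
    Claim189 (new189 D) (chiPP D) := by
  subst hD
  have hN₀' : (2 + (121 / 120) ^ 2 * (σ.O1 * σ.B₃ * σ.B₅ * (M : ℝ) ^ 5)) * ((σ.L₀ ^ 2) ^ (k' - (k' - N₀) - 1))⁻¹ ≤ 1 / 4 := by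
    rw [show k' - (k' - N₀) - 1 = N₀ - 1 from by omega]; exact hN₀
  exact claim189_assembly_printed_of_flow (D189OfHist ν P (sitOfHist ν A₁ M Nm P σ g s N₀ p₁) g)
    (pinLevels_h_le_k₀ (σ.pinTerm s) M Nm N₀ hNN) (pinLevels_k₀_add_two_le_k (σ.pinTerm s) M Nm N₀ hN2 hNk)
    (omegaOfChain_succ_subset s) (omegaOfChain_top_subset s le_rfl) rfl hβ0 hβ hL₀ hL₀L hε0 hε1
    (pinLevels_M_B_nonneg (σ.pinTerm s) M Nm N₀ hB).2 hδ (Nat.cast_nonneg _) hdist hN₀' hMl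
    (hjEqK_of_nested _ (omegaOfChain_succ_subset s) hZk) hgeom hβ₀0 hβ₀ hflow hbox L91h L95 L91 L97 L80

/-- **THE SAME ALONG A GENERATED HISTORY IN A (2.7)-SMALL WINDOW** (module 11's `claim189_sitOfTerm_of_inInterval` by the tokens): `g = genSeq β g₀` in `]0, γ]` up to `k′`, `β ≤ β′` along
it, `SmallnessFor γ β′ β₀ L p₀`, `β₀ ≤ ½`, `0 ≤ A₀`, `γA₀(log γ⁻²)^{p₀} ≤ 1/10` DISCHARGE the flow inputs (module 5 §1).  At Record 13: `β := betaOfRecord₁₃ θ`, `g₀ := P.g0`,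
`γ := θ.γ`. [cite: Balaban1989LargeFieldI, (1.89) p.198, pp.199–200; Balaban1988Convergent, (2.4)–(2.8) pp.255–256] -/
theorem claim189_sitOfHist_of_inInterval (β : HBeta) {s : SeqOfRecord F ν M (genSeq β P.g0) P.K k'}
    {D : Setting189 (F.P P.K) (SU N) (MSField (F.P P.K) (SU N) × ((j : ℕ) → VecField (F.P P.K) j (EuclideanSpace ℝ (Fin (N ^ 2 - 1))))) (Pt (F.P P.K).d)}
    (hD : D = D189OfHist ν P (sitOfHist ν A₁ M Nm P σ (genSeq β P.g0) s N₀ p₁) (genSeq β P.g0))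
    (hN2 : 2 ≤ N₀) (hNN : N₀ ≤ Nm) (hNk : N₀ ≤ k')
    (hβ0 : 0 ≤ σ.β) (hβ : σ.β ≤ 1 / 4) (hL₀ : 2 ≤ σ.L₀) (hL₀L : σ.L₀ ^ 2 ≤ ((F.P P.K).L : ℝ))
    (hB : 0 ≤ σ.O1 * σ.B₃ * σ.B₅) (hδ : 0 ≤ σ.δ) (hdist : ∀ p, 0 ≤ σ.dist p)
    (hN₀ : (2 + (121 / 120) ^ 2 * (σ.O1 * σ.B₃ * σ.B₅ * (M : ℝ) ^ 5)) * ((σ.L₀ ^ 2) ^ (N₀ - 1))⁻¹ ≤ 1 / 4)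
    (hMl : (121 / 120) ^ 2 * (σ.O1 * σ.B₃ * σ.B₅ * (M : ℝ) ^ 5) * Real.exp (-(4 * σ.δ * (M : ℝ))) ≤ 1 / 12)
    (hA₀ : 0 ≤ ν.A₀) {γ β' β₀ : ℝ} {L : ℕ} (S : SmallnessFor γ β' β₀ L ν.p₀) (hβ₀ : β₀ ≤ 1 / 2) (hε10 : γ * p0Profile ν.A₀ ν.p₀ γ ≤ 1 / 10)
    (hI : Step.InInterval γ k' (genSeq β P.g0)) (hub : ∀ j, j < k' → β j (prefixOf (genSeq β P.g0) j) ≤ β')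
    (hZk : ∀ m, k' - N₀ < m → m < k' → σ.Zpp k' ∩ omegaOfChain s m ⊆ omegaOfChain s (m + 1))
    (hgeom : ∀ m, D.k₀ < m → m < D.k → ∀ p ∈ plaqsOf (D.Ω m \ D.Ω (m + 1)), 4 * ((m : ℝ) - D.k₀) * D.M ≤ D.dist p)
    (hbox : ∀ p ∈ plaqsOf (half D), D.boxOf p ∈ D.halfcubes ∧ p ∈ D.plaqT (D.boxOf p))
    (L91h : ∀ U, new189 D U → ∀ p ∈ plaqsOf (half D),
      Ineq191 (dist1 (plaqHol (D.Upp U) p)) (D.devV'' U p) D.α ((D.L ^ D.h)⁻¹) (D.ε D.h) (E124 D.ε D.L D.η D.k D.h))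
    (L95 : ∀ U, new189 D U → ∀ p ∈ plaqsOf (half D),
      Ineq195 (D.devV'' U p) (dist1 (plaqHol (D.Uhalf U (D.boxOf p)) p)) D.α ((D.L ^ D.h)⁻¹) (D.ε D.h) (E124 D.ε D.L D.η D.k D.h))
    (L91 : ∀ U, new189 D U → ∀ j, D.h ≤ j → j ≤ D.k → ∀ p ∈ plaqsOf (dom D j),
      Ineq191 (dist1 (plaqHol (D.Upp U) p)) (D.dev97 U p) D.α ((D.L ^ j)⁻¹) (D.ε j) (E124 D.ε D.L D.η D.k j))
    (L97 : ∀ U, new189 D U → ∀ j, D.h ≤ j → j ≤ D.k → ∀ p ∈ plaqsOf (dom D j),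
      Ineq191 (D.dev97 U p) (D.dev0 U p) D.α ((D.L ^ j)⁻¹) (D.ε j) (E124 D.ε D.L D.η D.k j))
    (L80 : ∀ U, new189 D U → ∀ j, D.h ≤ j → j ≤ D.k → ∀ p ∈ plaqsOf (dom D j),
      Ineq180 (D.dev0 U p) (D.ε D.k) D.η D.B₃ D.B₅ D.M D.δ (D.dist p) D.O1) :
    Claim189 (new189 D) (chiPP D) := by
  refine claim189_sitOfHist_of_flow Nm P σ s N₀ p₁ hD hN2 hNN hNk hβ0 hβ hL₀ hL₀L hB hδ hdist hN₀ hMl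
    (fun i _ hik => epsOfRecord_nonneg_of_inInterval ν hA₀ S.γ_lt_one.le hI hik) (fun i _ hik => epsOfRecord_le_of_inInterval ν hA₀ S hε10 hI hik)
    S.β₀_pos.le hβ₀ (fun j _ hjk => ?_) hZk hgeom hbox L91h L95 L91 L97 L80
  rw [Nat.cast_sub hjk.le]
  exact epsOfRecord_flow28a_of_inInterval ν hA₀ S β P.g0 hI hub hjk le_rfl

/-- **(1.89) WITH `N₀ := N₀ OF THE HISTORY`, WINDOW-FREE FORM** (module 12's `claim189_sitOfTerm_N0_of_flow` by the tokens): at `N₀ := N0OfSeq L r g k′` the level input `2 ≤ N₀` and print's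
first p. 200 condition become their sources — `1 < (log g_{k′}⁻²)^r` and `(2 + C)((L₀²)^{N₀−1})⁻¹ ≤ 1/4` DISPLAYED as such (the threshold theorem `printCond1_N0OfSeq_of_threshold`
supplies the latter along a generated history). [cite: Balaban1989LargeFieldI, (1.89) p.198, pp.199–200; Balaban1988Convergent, (2.5)–(2.8) pp.255–256] -/
theorem claim189_sitOfHist_N0_of_flow
    {D : Setting189 (F.P P.K) (SU N) (MSField (F.P P.K) (SU N) × ((j : ℕ) → VecField (F.P P.K) j (EuclideanSpace ℝ (Fin (N ^ 2 - 1))))) (Pt (F.P P.K).d)}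
    (hD : D = D189OfHist ν P (sitOfHist ν A₁ M Nm P σ g s (N0OfSeq (F.P P.K).L ν.r g k') p₁) g)
    (hlog : 1 < (Real.log (g k' ^ 2)⁻¹) ^ ν.r) (hNN : N0OfSeq (F.P P.K).L ν.r g k' ≤ Nm) (hNk : N0OfSeq (F.P P.K).L ν.r g k' ≤ k')
    (hβ0 : 0 ≤ σ.β) (hβ : σ.β ≤ 1 / 4) (hL₀ : 2 ≤ σ.L₀) (hL₀L : σ.L₀ ^ 2 ≤ ((F.P P.K).L : ℝ))
    (hB : 0 ≤ σ.O1 * σ.B₃ * σ.B₅) (hδ : 0 ≤ σ.δ) (hdist : ∀ p, 0 ≤ σ.dist p)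
    (hN₀ : (2 + (121 / 120) ^ 2 * (σ.O1 * σ.B₃ * σ.B₅ * (M : ℝ) ^ 5)) * ((σ.L₀ ^ 2) ^ (N0OfSeq (F.P P.K).L ν.r g k' - 1))⁻¹ ≤ 1 / 4)
    (hMl : (121 / 120) ^ 2 * (σ.O1 * σ.B₃ * σ.B₅ * (M : ℝ) ^ 5) * Real.exp (-(4 * σ.δ * (M : ℝ))) ≤ 1 / 12)
    (hε0 : ∀ i, k' - Nm ≤ i → i ≤ k' → 0 ≤ epsOfRecord ν g i) (hε1 : ∀ i, k' - Nm ≤ i → i ≤ k' → epsOfRecord ν g i ≤ 1 / 10)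
    {β₀ : ℝ} (hβ₀0 : 0 ≤ β₀) (hβ₀ : β₀ ≤ 1 / 2)
    (hflow : ∀ j, k' - Nm ≤ j → j < k' → epsOfRecord ν g k' ≤ (1 + β₀) * Real.sqrt ((k' - j : ℕ) : ℝ) * epsOfRecord ν g j)
    (hZk : ∀ m, k' - N0OfSeq (F.P P.K).L ν.r g k' < m → m < k' → σ.Zpp k' ∩ omegaOfChain s m ⊆ omegaOfChain s (m + 1))
    (hgeom : ∀ m, D.k₀ < m → m < D.k → ∀ p ∈ plaqsOf (D.Ω m \ D.Ω (m + 1)), 4 * ((m : ℝ) - D.k₀) * D.M ≤ D.dist p)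
    (hbox : ∀ p ∈ plaqsOf (half D), D.boxOf p ∈ D.halfcubes ∧ p ∈ D.plaqT (D.boxOf p))
    (L91h : ∀ U, new189 D U → ∀ p ∈ plaqsOf (half D),
      Ineq191 (dist1 (plaqHol (D.Upp U) p)) (D.devV'' U p) D.α ((D.L ^ D.h)⁻¹) (D.ε D.h) (E124 D.ε D.L D.η D.k D.h))
    (L95 : ∀ U, new189 D U → ∀ p ∈ plaqsOf (half D),
      Ineq195 (D.devV'' U p) (dist1 (plaqHol (D.Uhalf U (D.boxOf p)) p)) D.α ((D.L ^ D.h)⁻¹) (D.ε D.h) (E124 D.ε D.L D.η D.k D.h))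
    (L91 : ∀ U, new189 D U → ∀ j, D.h ≤ j → j ≤ D.k → ∀ p ∈ plaqsOf (dom D j),
      Ineq191 (dist1 (plaqHol (D.Upp U) p)) (D.dev97 U p) D.α ((D.L ^ j)⁻¹) (D.ε j) (E124 D.ε D.L D.η D.k j))
    (L97 : ∀ U, new189 D U → ∀ j, D.h ≤ j → j ≤ D.k → ∀ p ∈ plaqsOf (dom D j),
      Ineq191 (D.dev97 U p) (D.dev0 U p) D.α ((D.L ^ j)⁻¹) (D.ε j) (E124 D.ε D.L D.η D.k j))
    (L80 : ∀ U, new189 D U → ∀ j, D.h ≤ j → j ≤ D.k → ∀ p ∈ plaqsOf (dom D j),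
      Ineq180 (D.dev0 U p) (D.ε D.k) D.η D.B₃ D.B₅ D.M D.δ (D.dist p) D.O1) :
    Claim189 (new189 D) (chiPP D) :=
  claim189_sitOfHist_of_flow Nm P σ s _ p₁ hD (two_le_N0OfSeq_of_hist ν P g hlog) hNN hNk hβ0 hβ hL₀ hL₀L hB hδ hdist hN₀ hMl hε0 hε1 hβ₀0 hβ₀ hflow hZk hgeom hbox
    L91h L95 L91 L97 L80


/-- **(1.89) WITH `N₀` OF THE HISTORY AND PRINT'S `Z″_j` PINNED TO THE TERM'S CHAIN, WINDOW-FREE FORM** (module 13's `claim189_sitOfTerm_N0Z_of_flow` by the tokens): at the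
`Z″`-pinned situation `σ.pinZpp s N₀ N enl` (`N₀ := N0OfSeq L r g k′`, enlargement inflationary) the located input `hZk` («We have j = k») is DISCHARGED (`zppOfChain_hZk`).
[cite: Balaban1989LargeFieldI, (1.89) p.198, (1.10)–(1.11) p.179, pp.199–200; Balaban1988Convergent, (2.1) p.254] -/
theorem claim189_sitOfHist_N0Z_of_flow (enl : ℕ → ℕ → Set (Site (F.P P.K) 0) → Set (Site (F.P P.K) 0)) (henl : ∀ n j (S : Set (Site (F.P P.K) 0)), S ⊆ enl n j S)
    {D : Setting189 (F.P P.K) (SU N) (MSField (F.P P.K) (SU N) × ((j : ℕ) → VecField (F.P P.K) j (EuclideanSpace ℝ (Fin (N ^ 2 - 1))))) (Pt (F.P P.K).d)}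
    (hD : D = D189OfHist ν P (sitOfHist ν A₁ M Nm P (σ.pinZpp s (N0OfSeq (F.P P.K).L ν.r g k') Nm enl) g s (N0OfSeq (F.P P.K).L ν.r g k') p₁) g)
    (hlog : 1 < (Real.log (g k' ^ 2)⁻¹) ^ ν.r) (hNN : N0OfSeq (F.P P.K).L ν.r g k' ≤ Nm) (hNk : N0OfSeq (F.P P.K).L ν.r g k' ≤ k')
    (hβ0 : 0 ≤ σ.β) (hβ : σ.β ≤ 1 / 4) (hL₀ : 2 ≤ σ.L₀) (hL₀L : σ.L₀ ^ 2 ≤ ((F.P P.K).L : ℝ))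
    (hB : 0 ≤ σ.O1 * σ.B₃ * σ.B₅) (hδ : 0 ≤ σ.δ) (hdist : ∀ p, 0 ≤ σ.dist p)
    (hN₀ : (2 + (121 / 120) ^ 2 * (σ.O1 * σ.B₃ * σ.B₅ * (M : ℝ) ^ 5)) * ((σ.L₀ ^ 2) ^ (N0OfSeq (F.P P.K).L ν.r g k' - 1))⁻¹ ≤ 1 / 4)
    (hMl : (121 / 120) ^ 2 * (σ.O1 * σ.B₃ * σ.B₅ * (M : ℝ) ^ 5) * Real.exp (-(4 * σ.δ * (M : ℝ))) ≤ 1 / 12)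
    (hε0 : ∀ i, k' - Nm ≤ i → i ≤ k' → 0 ≤ epsOfRecord ν g i) (hε1 : ∀ i, k' - Nm ≤ i → i ≤ k' → epsOfRecord ν g i ≤ 1 / 10)
    {β₀ : ℝ} (hβ₀0 : 0 ≤ β₀) (hβ₀ : β₀ ≤ 1 / 2)
    (hflow : ∀ j, k' - Nm ≤ j → j < k' → epsOfRecord ν g k' ≤ (1 + β₀) * Real.sqrt ((k' - j : ℕ) : ℝ) * epsOfRecord ν g j)
    (hgeom : ∀ m, D.k₀ < m → m < D.k → ∀ p ∈ plaqsOf (D.Ω m \ D.Ω (m + 1)), 4 * ((m : ℝ) - D.k₀) * D.M ≤ D.dist p)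
    (hbox : ∀ p ∈ plaqsOf (half D), D.boxOf p ∈ D.halfcubes ∧ p ∈ D.plaqT (D.boxOf p))
    (L91h : ∀ U, new189 D U → ∀ p ∈ plaqsOf (half D),
      Ineq191 (dist1 (plaqHol (D.Upp U) p)) (D.devV'' U p) D.α ((D.L ^ D.h)⁻¹) (D.ε D.h) (E124 D.ε D.L D.η D.k D.h))
    (L95 : ∀ U, new189 D U → ∀ p ∈ plaqsOf (half D),
      Ineq195 (D.devV'' U p) (dist1 (plaqHol (D.Uhalf U (D.boxOf p)) p)) D.α ((D.L ^ D.h)⁻¹) (D.ε D.h) (E124 D.ε D.L D.η D.k D.h))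
    (L91 : ∀ U, new189 D U → ∀ j, D.h ≤ j → j ≤ D.k → ∀ p ∈ plaqsOf (dom D j),
      Ineq191 (dist1 (plaqHol (D.Upp U) p)) (D.dev97 U p) D.α ((D.L ^ j)⁻¹) (D.ε j) (E124 D.ε D.L D.η D.k j))
    (L97 : ∀ U, new189 D U → ∀ j, D.h ≤ j → j ≤ D.k → ∀ p ∈ plaqsOf (dom D j),
      Ineq191 (D.dev97 U p) (D.dev0 U p) D.α ((D.L ^ j)⁻¹) (D.ε j) (E124 D.ε D.L D.η D.k j))
    (L80 : ∀ U, new189 D U → ∀ j, D.h ≤ j → j ≤ D.k → ∀ p ∈ plaqsOf (dom D j),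
      Ineq180 (D.dev0 U p) (D.ε D.k) D.η D.B₃ D.B₅ D.M D.δ (D.dist p) D.O1) :
    Claim189 (new189 D) (chiPP D) :=
  claim189_sitOfHist_N0_of_flow Nm P (σ.pinZpp s (N0OfSeq (F.P P.K).L ν.r g k') Nm enl) s p₁ hD hlog hNN hNk hβ0 hβ hL₀ hL₀L hB hδ hdist hN₀ hMl hε0 hε1 hβ₀0 hβ₀
    hflow (zppOfChain_hZk s _ Nm σ.Z enl σ.Zpp henl (two_le_N0OfSeq_of_hist ν P g hlog) hNN) hgeom hbox L91h L95 L91 L97 L80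

end Display

/-! ## §7. AT RECORD 13: the window form instantiated along `gOfRecord₁₃ θ P = genSeq (betaOfRecord₁₃ θ) g₀` -/

section Record13

variable (θ : Stage13Params F N) (Nm : ℕ) (P : B12.RunParams) (σ : Sit189 F N P.K) {k' : ℕ} (s : SeqOfRecord F θ.ν θ.τ9.M (gOfRecord₁₃ F N θ P) P.K k') (p₁ : ℕ)

variable {θ} in
/-- **(1.89) AT THE TERM'S FULLY PINNED LETTERS OF RECORD 13 WITH `N₀ := N0OfRecord₁₃ θ P k′`, IN THE RUN'S (2.7)-SMALL WINDOW** — §6's theorems at the Stage-13 tokens: the level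
input `2 ≤ N₀` from `r ≥ 1`, print's first p. 200 condition from ONE threshold on `g_{k′}` and `β₁₃ ≥ 0` along the history, the flow inputs from the window `]0, θ.γ]` up to `k′`
with the BOX bound `BetaUpperH β′ θ.γ (betaOfRecord₁₃ θ)`; memory `N` a parameter (`N₀ ≤ N`); residual numerics, print's second condition, the located geometry, the ℍ-leaves and
(1.80) displayed — exactly module 12's `claim189_sitOfTerm_N0_of_inInterval`, now along `gOfRecord₁₃`. [cite: Balaban1989LargeFieldI, (1.89) p.198, pp.199–200; Balaban1988Convergent, (2.1) p.254, (2.4)–(2.8) pp.255–256; Balaban1987RG1, §1 p.264] -/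
theorem claim189_sitOfHist₁₃_N0_of_inInterval
    {D : Setting189 (F.P P.K) (SU N) (MSField (F.P P.K) (SU N) × ((j : ℕ) → VecField (F.P P.K) j (EuclideanSpace ℝ (Fin (N ^ 2 - 1))))) (Pt (F.P P.K).d)}
    (hD : D = D189OfHist θ.ν P (sitOfHist θ.ν θ.A₁ θ.τ9.M Nm P σ (gOfRecord₁₃ F N θ P) s (N0OfRecord₁₃ θ P k') p₁) (gOfRecord₁₃ F N θ P))
    (hr : 1 ≤ θ.ν.r) (hNN : N0OfRecord₁₃ θ P k' ≤ Nm) (hNk : N0OfRecord₁₃ θ P k' ≤ k')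
    (hβ0 : 0 ≤ σ.β) (hβ : σ.β ≤ 1 / 4) (hL₀ : 2 ≤ σ.L₀) (hL₀L : σ.L₀ ^ 2 ≤ ((F.P P.K).L : ℝ))
    (hB : 0 ≤ σ.O1 * σ.B₃ * σ.B₅) (hδ : 0 ≤ σ.δ) (hdist : ∀ p, 0 ≤ σ.dist p)
    (hwin : 4 * (2 + (121 / 120) ^ 2 * (σ.O1 * σ.B₃ * σ.B₅ * (θ.τ9.M : ℝ) ^ 5))
      ≤ ((Real.log (gOfRecord₁₃ F N θ P k' ^ 2)⁻¹) ^ θ.ν.r) ^ (Real.log (σ.L₀ ^ 2) / Real.log ((F.P P.K).L : ℝ)))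
    (hβhist : ∀ j, j < k' → 0 ≤ betaOfRecord₁₃ F N θ j (prefixOf (gOfRecord₁₃ F N θ P) j))
    (hMl : (121 / 120) ^ 2 * (σ.O1 * σ.B₃ * σ.B₅ * (θ.τ9.M : ℝ) ^ 5) * Real.exp (-(4 * σ.δ * (θ.τ9.M : ℝ))) ≤ 1 / 12)
    (hA₀ : 0 ≤ θ.ν.A₀) {β' β₀ : ℝ} {L : ℕ} (S : SmallnessFor θ.γ β' β₀ L θ.ν.p₀) (hβ₀ : β₀ ≤ 1 / 2) (hε10 : θ.γ * p0Profile θ.ν.A₀ θ.ν.p₀ θ.γ ≤ 1 / 10)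
    (hI : Step.InInterval θ.γ k' (gOfRecord₁₃ F N θ P)) (hup : BetaUpperH β' θ.γ (betaOfRecord₁₃ F N θ))
    (hZk : ∀ m, k' - N0OfRecord₁₃ θ P k' < m → m < k' → σ.Zpp k' ∩ omegaOfChain s m ⊆ omegaOfChain s (m + 1))
    (hgeom : ∀ m, D.k₀ < m → m < D.k → ∀ p ∈ plaqsOf (D.Ω m \ D.Ω (m + 1)), 4 * ((m : ℝ) - D.k₀) * D.M ≤ D.dist p)
    (hbox : ∀ p ∈ plaqsOf (half D), D.boxOf p ∈ D.halfcubes ∧ p ∈ D.plaqT (D.boxOf p))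
    (L91h : ∀ U, new189 D U → ∀ p ∈ plaqsOf (half D),
      Ineq191 (dist1 (plaqHol (D.Upp U) p)) (D.devV'' U p) D.α ((D.L ^ D.h)⁻¹) (D.ε D.h) (E124 D.ε D.L D.η D.k D.h))
    (L95 : ∀ U, new189 D U → ∀ p ∈ plaqsOf (half D),
      Ineq195 (D.devV'' U p) (dist1 (plaqHol (D.Uhalf U (D.boxOf p)) p)) D.α ((D.L ^ D.h)⁻¹) (D.ε D.h) (E124 D.ε D.L D.η D.k D.h))
    (L91 : ∀ U, new189 D U → ∀ j, D.h ≤ j → j ≤ D.k → ∀ p ∈ plaqsOf (dom D j),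
      Ineq191 (dist1 (plaqHol (D.Upp U) p)) (D.dev97 U p) D.α ((D.L ^ j)⁻¹) (D.ε j) (E124 D.ε D.L D.η D.k j))
    (L97 : ∀ U, new189 D U → ∀ j, D.h ≤ j → j ≤ D.k → ∀ p ∈ plaqsOf (dom D j),
      Ineq191 (D.dev97 U p) (D.dev0 U p) D.α ((D.L ^ j)⁻¹) (D.ε j) (E124 D.ε D.L D.η D.k j))
    (L80 : ∀ U, new189 D U → ∀ j, D.h ≤ j → j ≤ D.k → ∀ p ∈ plaqsOf (dom D j),
      Ineq180 (D.dev0 U p) (D.ε D.k) D.η D.B₃ D.B₅ D.M D.δ (D.dist p) D.O1) :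
    Claim189 (new189 D) (chiPP D) :=
  claim189_sitOfHist_of_inInterval Nm P σ (N0OfRecord₁₃ θ P k') p₁ (betaOfRecord₁₃ F N θ) hD
    (two_le_N0OfSeq_of_hist θ.ν P (gOfRecord₁₃ F N θ P) (one_lt_log_pow_of_inInterval_hist θ.ν S hI hr)) hNN hNk hβ0 hβ hL₀ hL₀L hB hδ hdist
    (printCond1_N0OfSeq_of_threshold θ.ν P (betaOfRecord₁₃ F N θ) S.γ_lt_one.le hI hβhist (by linarith) hwin) hMl hA₀ S hβ₀ hε10 hI
    (betaAlongHistory_le_of_betaUpperH hup hI) hZk hgeom hbox L91h L95 L91 L97 L80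

end Record13

/-! ## §8. A2 — the pinned displays TESTED AT THE UNIT CONFIGURATION along any history in a window (modules 8 ∕ 9 by the tokens) -/

section UnitTest

open B15Ineq180PinAtRecord (U0OfRecord dist1_plaqHol_U0OfRecord_one)
open B15Claim189UnitTestAtRecord (chi124std_bgOfRecord_one)

variable (ν : Stage7Numerics) (P : B12.RunParams) (σ : Sit189 F N P.K) (g : ℕ → ℝ)

/-- **(1.80) HOLDS AT THE UNIT CONFIGURATION for the objects of record along any history** (module 8's `ineq180_pinDev0_one` by the tokens): `U₀` of record at the unit datum is
flat, so (1.80) reads `0 < (2 + O(1)B₃B₅M⁵e^{−δ dist}) ε_kη_k²` — true for `ε_k > 0`, `εreg > 0`, `0 ≤ O(1)B₃B₅M⁵`. [cite: Balaban1989LargeFieldI, (1.80) p.195 (bookkeeping witness)] -/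
theorem ineq180_D189OfHist_pinDev0_one (hreg : 0 < ν.εreg) (hεk : 0 < epsOfRecord ν g σ.k) (hB : 0 ≤ σ.O1 * σ.B₃ * σ.B₅ * σ.M ^ 5)
    (B' : (j : ℕ) → VecField (F.P P.K) j σ.𝔤) (q : Plaq (F.P P.K) 0) :
    Ineq180 ((D189OfHist ν P (σ.pinDev0 ν) g).dev0 ((1 : MSField (F.P P.K) (SU N)), B') q) (epsOfRecord ν g σ.k) ((F.P P.K).eta σ.k) σ.B₃ σ.B₅ σ.M σ.δ (σ.dist q) σ.O1 := by
  have h1 : (1 : GaugeField (F.P P.K) 0 (SU N)) ∈ {U : GaugeField (F.P P.K) 0 (SU N) | PlaqSmall (ν.εreg * (F.P P.K).eta σ.k ^ 2) U} :=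
    one_mem_plaqSmall (mul_pos hreg (pow_pos (pow_pos (inv_pos.mpr (F.P P.K).cast_L_pos) σ.k) 2))
  have hη : 0 < (F.P P.K).eta σ.k ^ 2 := pow_pos (pow_pos (inv_pos.mpr (F.P P.K).cast_L_pos) σ.k) 2
  show dist1 (plaqHol (U0OfRecord (bgOfRecord (avOfRecord F N P.K) {U | PlaqSmall (ν.εreg * (F.P P.K).eta σ.k ^ 2) U}) ν.M₁ σ.Z σ.Λ σ.k
      (1 : GaugeField (F.P P.K) σ.k (SU N))) q)
    < 2 * epsOfRecord ν g σ.k * (F.P P.K).eta σ.k ^ 2 + σ.O1 * σ.B₃ * σ.B₅ * σ.M ^ 5 * Real.exp (-σ.δ * σ.dist q) * epsOfRecord ν g σ.k * (F.P P.K).eta σ.k ^ 2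
  rw [dist1_plaqHol_U0OfRecord_one _ h1]
  have hA : 0 < 2 * epsOfRecord ν g σ.k * (F.P P.K).eta σ.k ^ 2 := mul_pos (mul_pos two_pos hεk) hη
  have hC : 0 ≤ σ.O1 * σ.B₃ * σ.B₅ * σ.M ^ 5 * Real.exp (-σ.δ * σ.dist q) * epsOfRecord ν g σ.k * (F.P P.K).eta σ.k ^ 2 :=
    mul_nonneg (mul_nonneg (mul_nonneg hB (Real.exp_nonneg _)) hεk.le) hη.le
  linarith

/-- **THE CONSEQUENT OF (1.89) AT THE UNIT CONFIGURATION along any history** (module 9's `chiPP_D189OfRecord_one` by the tokens): r11's concrete `χ″_k` HOLDS at `U″_{k,Z}(1)` of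
record for `σ.h ≤ σ.k`, `εreg > 0`, `0 < ε_i` on `[σ.h, σ.k]`, `0 ≤ σ.β < 1`, `0 < σ.L₀`. [cite: Balaban1989LargeFieldI, (1.89) p.198, (1.24) p.182 (bookkeeping witness)] -/
theorem chiPP_D189OfHist_one (hhk : σ.h ≤ σ.k) (hreg : 0 < ν.εreg) (hε : ∀ i, σ.h ≤ i → i ≤ σ.k → 0 < epsOfRecord ν g i)
    (hβ0 : 0 ≤ σ.β) (hβ1 : σ.β < 1) (hL₀ : 0 < σ.L₀) (B' : (j : ℕ) → VecField (F.P P.K) j σ.𝔤) :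
    chiPP (D189OfHist ν P σ g) ((1 : MSField (F.P P.K) (SU N)), B') := by
  rw [chiPP_D189OfHist_iff ν P σ g hhk]
  exact chi124std_bgOfRecord_one _ ν.M₁ σ.Ω σ.Zpp σ.Z σ.h σ.k
    (one_mem_plaqSmall (mul_pos hreg (pow_pos (pow_pos (inv_pos.mpr (F.P P.K).cast_L_pos) σ.k) 2))) hhk σ.k₀ hβ0 hβ1 hL₀ hε

variable {ν} {A₁ : ℝ} {M : ℕ} (lam : ResidW F N) (gT : B12.RunParams → ℕ → ℝ) (σT : ∀ P : B12.RunParams, Sit189 F N P.K)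
  (sT : ∀ P : B12.RunParams, SeqOfRecord F ν M (gT P) P.K (lam.kSel P + 1)) (NmT N₀T : B12.RunParams → ℕ) (p₁ : ℕ)

/-- **A2 — BOTH [IV] DISPLAYS TESTED AT THE UNIT CONFIGURATION AT THE TERM-PINNED LAYER BY THE TOKENS** (module 11's `displays_tested_at_one_pinD189T_of_admissible` along any history):
for a run whose history `g P` lies in `]0, γ]` up to `n ≥ kSel P + 1` (`γ < 1`), `0 < εreg`, `0 < A₀`, `0 < A₁`, residual `0 ≤ β < 1`, `0 < L₀`, `0 ≤ O(1)B₃B₅`, at `U = (1, 0)`: the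
antecedent `new189` HOLDS, the (1.80) body HOLDS, the consequent `χ″_k` of (1.89) HOLDS — the Record-13 instance is `g := gOfRecord₁₃ θ`, `γ := θ.γ`.
[cite: Balaban1989LargeFieldI, (1.80) p.195, (1.89) p.198, (1.82) p.196, (1.24) p.182 (bookkeeping witness)] -/
theorem displays_tested_at_one_pinD189TH (hreg : 0 < ν.εreg) (hA₀ : 0 < ν.A₀) (hA₁ : 0 < A₁) {γ : ℝ} (hγ1 : γ < 1) (P : B12.RunParams) {n : ℕ}
    (hI : Step.InInterval γ n (gT P)) (hkn : lam.kSel P + 1 ≤ n) (hβ0 : 0 ≤ (σT P).β) (hβ1 : (σT P).β < 1) (hL₀ : 0 < (σT P).L₀)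
    (hB : 0 ≤ (σT P).O1 * (σT P).B₃ * (σT P).B₅) :
    new189 ((lam.pinD189TH ν A₁ M gT σT sT NmT N₀T p₁).D189 P) ((1 : MSField (F.P P.K) (SU N)), fun _ _ => (0 : EuclideanSpace ℝ (Fin (N ^ 2 - 1)))) ∧
    (∀ i, ((lam.pinD189TH ν A₁ M gT σT sT NmT N₀T p₁).D189 P).h ≤ i → i ≤ ((lam.pinD189TH ν A₁ M gT σT sT NmT N₀T p₁).D189 P).k →
      ∀ q ∈ plaqsOf (dom ((lam.pinD189TH ν A₁ M gT σT sT NmT N₀T p₁).D189 P) i),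
      Ineq180 (((lam.pinD189TH ν A₁ M gT σT sT NmT N₀T p₁).D189 P).dev0 ((1 : MSField (F.P P.K) (SU N)), fun _ _ => (0 : EuclideanSpace ℝ (Fin (N ^ 2 - 1)))) q)
        (((lam.pinD189TH ν A₁ M gT σT sT NmT N₀T p₁).D189 P).ε ((lam.pinD189TH ν A₁ M gT σT sT NmT N₀T p₁).D189 P).k)
        ((lam.pinD189TH ν A₁ M gT σT sT NmT N₀T p₁).D189 P).η ((lam.pinD189TH ν A₁ M gT σT sT NmT N₀T p₁).D189 P).B₃
        ((lam.pinD189TH ν A₁ M gT σT sT NmT N₀T p₁).D189 P).B₅ ((lam.pinD189TH ν A₁ M gT σT sT NmT N₀T p₁).D189 P).M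
        ((lam.pinD189TH ν A₁ M gT σT sT NmT N₀T p₁).D189 P).δ (((lam.pinD189TH ν A₁ M gT σT sT NmT N₀T p₁).D189 P).dist q)
        ((lam.pinD189TH ν A₁ M gT σT sT NmT N₀T p₁).D189 P).O1) ∧
    chiPP ((lam.pinD189TH ν A₁ M gT σT sT NmT N₀T p₁).D189 P) ((1 : MSField (F.P P.K) (SU N)), fun _ _ => (0 : EuclideanSpace ℝ (Fin (N ^ 2 - 1)))) := by
  -- the situation before the `dev0` pin
  set σ₁ := (((σT P).pinTerm (sT P)).pinLevels M (NmT P) (N₀T P)).pinChi182 (deltaPrimeOfHist A₁ p₁ (gT P) (lam.kSel P + 1))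
  have hhk : σ₁.h ≤ σ₁.k := pinLevels_h_le_k ((σT P).pinTerm (sT P)) M (NmT P) (N₀T P)
  have hkn : σ₁.k ≤ n := hkn
  have hεi : ∀ i, σ₁.h ≤ i → i ≤ σ₁.k → 0 < epsOfRecord ν (gT P) i := fun i _ hik => epsOfRecord_pos_of_inInterval ν hA₀ hγ1 hI (hik.trans hkn)
  have hB' : 0 ≤ σ₁.O1 * σ₁.B₃ * σ₁.B₅ * σ₁.M ^ 5 := (pinLevels_M_B_nonneg ((σT P).pinTerm (sT P)) M (NmT P) (N₀T P) hB).2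
  have hD : (lam.pinD189TH ν A₁ M gT σT sT NmT N₀T p₁).D189 P = D189OfHist ν P (σ₁.pinDev0 ν) (gT P) := rfl
  refine ⟨?_, ?_, ?_⟩
  · rw [hD]
    exact (new189_D189OfHist_one_iff ν P (σ₁.pinDev0 ν) (gT P) hhk hreg (hεi _ hhk le_rfl) (hεi _ le_rfl hhk) _).2
      (chiP_pinChi182_zero _ _ (deltaPrimeOfHist_pos_of_inInterval p₁ hA₁ hγ1 hI hkn))
  · rw [hD]
    exact fun _ _ _ q _ => ineq180_D189OfHist_pinDev0_one ν P σ₁ (gT P) hreg (hεi _ hhk le_rfl) hB' _ q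
  · rw [hD]
    exact chiPP_D189OfHist_one ν P (σ₁.pinDev0 ν) (gT P) hhk hreg hεi hβ0 hβ1 hL₀ _

end UnitTest

/-! ## §9. (v1.1) The displayed window ∕ β-inputs ARE the run's DAG leaves at a world carrying a generated flow; at RECORD 13 the flow IS `genFlow (betaOfRecord₁₃ θ) g₀` (`rfl`)
and the sign inputs are clauses of `Stage13Params.Admissible` -/

section Leaves

open FlowStepRuns (genFlow)
open B15Claim189FlowAtRecord (beta_genFlow_succ_apply)

variable {β : HBeta} {w : WorldP} {P : B12.RunParams}

/-- **THE WINDOW IS THE RUN'S `smallCouplings` LEAF** (module 5's `inInterval_gOfRecord₁₀_of_smallCouplings` for any generating `β`): at a world whose construction carries the flow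
`genFlow β g₀` at the run `P`, with window constant `w.γ ≤ γ`, the leaf gives `Step.InInterval γ n (genSeq β g₀)` for `n ≤ P.K`. [cite: Balaban1987RG1, Thm 1 p.256; Balaban1989LargeFieldII, Thm 1 p.355] -/
theorem inInterval_genSeq_of_smallCouplings (hfl : (w.C P).flow = genFlow β P.g0) {γ : ℝ} (hγ : w.γ ≤ γ) (hsc : (leavesP w P).smallCouplings) {n : ℕ} (hn : n ≤ P.K) :
    Step.InInterval γ n (genSeq β P.g0) := by
  have hsc' : (w.C P).flow.InInterval w.γ P.K := hsc
  rw [hfl] at hsc'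
  intro k hk
  obtain ⟨h0, h1⟩ := hsc' k (hk.trans hn)
  exact ⟨h0, h1.trans hγ⟩

/-- **`β ≤ βup` ALONG THE HISTORY IS THE RUN'S `betaSmoothBounded` LEAF** (module 5's twin for any generating `β`). [cite: Balaban1987RG1, §1 p.264] -/
theorem betaAlongHistory_le_of_betaSmoothBounded (hfl : (w.C P).flow = genFlow β P.g0) (hβ : (leavesP w P).betaSmoothBounded) {n : ℕ} (hn : n ≤ P.K) :
    ∀ j, j < n → β j (prefixOf (genSeq β P.g0) j) ≤ w.βup := by
  have hβ' : ∀ j, j < P.K → (w.C P).flow.β (j + 1) ((w.C P).flow.g j) ≤ w.βup := hβ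
  rw [hfl] at hβ'
  intro j hj
  rw [← beta_genFlow_succ_apply β P.g0 j]
  exact hβ' j (lt_of_lt_of_le hj hn)

/-- **`β ≥ 0` ALONG THE HISTORY IS THE RUN'S `betaPositive` LEAF** (module 12's `betaAlongHistory_nonneg_of_betaPositive` for any generating `β`; the `hβhist` input of §6–§7's
`N₀` theorems, the sign behind [III] (2.6)). [cite: Balaban1987RG1, Thm 2 ∕ (0.31) p.259, §1 p.264; Balaban1988Convergent, (2.6) p.255] -/
theorem betaAlongHistory_nonneg_of_betaPositive (hfl : (w.C P).flow = genFlow β P.g0) (hpos : (leavesP w P).betaPositive) {n : ℕ} (hn : n ≤ P.K) :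
    ∀ j, j < n → 0 ≤ β j (prefixOf (genSeq β P.g0) j) := by
  have h' : ∀ j, j < P.K → w.b ≤ (w.C P).flow.β (j + 1) ((w.C P).flow.g j) := hpos
  rw [hfl] at h'
  intro j hj
  rw [← beta_genFlow_succ_apply β P.g0 j]
  exact w.b_pos.le.trans (h' j (lt_of_lt_of_le hj hn))

/-- **AT RECORD 13 THE RUN'S FLOW IS GENERATED FORWARD BY `betaOfRecord₁₃ θ`** (`rfl`, def-T's `datumOfRecord₁₃` over `coreOfRecord₁₃`; the Stage-13 twin of `flow_datumOfRecord₁₀`):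
so at every world with `w.C = (datumOfRecord₁₃ θ h).C` the three leaf lemmas above read along `gOfRecord₁₃ θ P`. [cite: Balaban1987RG1, (0.17)–(0.20) pp.255–256 (bookkeeping)] -/
theorem flow_datumOfRecord₁₃ (θ : Stage13Params F N) (h : θ.Provisos₁₃ F N) (P : B12.RunParams) :
    ((datumOfRecord₁₃ F N θ h).C P).flow = genFlow (betaOfRecord₁₃ F N θ) P.g0 := rfl

/-- … hence at a world keyed on the Stage-13 datum. [cite: Balaban1987RG1, (0.17)–(0.20) pp.255–256 (bookkeeping)] -/
theorem flow_eq_genFlow_of_C_eq₁₃ {θ : Stage13Params F N} {h : θ.Provisos₁₃ F N} (hC : w.C = (datumOfRecord₁₃ F N θ h).C) (P : B12.RunParams) :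
    (w.C P).flow = genFlow (betaOfRecord₁₃ F N θ) P.g0 := by
  rw [hC]
  exact flow_datumOfRecord₁₃ θ h P

end Leaves

section Admissible13

variable {θ : Stage13Params F N}

/-- **THE SIGN INPUTS AT RECORD 13 ARE CLAUSES OF `Stage13Params.Admissible`** (`0 < A₀` and `0 < εreg` from the Stage-7 numeric window, `0 < A₁` and `γ < 1` from `Pos₁₂`).
[cite: Balaban1988Convergent, (2.4) p.255, (2.12) p.256, (3.4) p.265 (hypothesis dictionary)] -/
theorem signs_of_admissible₁₃ (hθ : θ.Admissible F N) : 0 < θ.ν.A₀ ∧ 0 < θ.ν.εreg ∧ 0 < θ.A₁ ∧ θ.γ < 1 :=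
  ⟨B15Claim189FlowAtRecord.A₀_pos_of_admissible hθ.1.1, hθ.1.1.1.1.2.2.1, hθ.1.2.2.2.1, hθ.1.2.2.2.2.2.2⟩

variable (θ) (lam : ResidW F N) (σT : ∀ P : B12.RunParams, Sit189 F N P.K)
  (sT : ∀ P : B12.RunParams, SeqOfRecord F θ.ν θ.τ9.M (gOfRecord₁₃ F N θ P) P.K (lam.kSel P + 1)) (NmT N₀T : B12.RunParams → ℕ) (p₁ : ℕ)

variable {θ} in
/-- **A2 AT RECORD 13 — BOTH [IV] DISPLAYS TESTED AT THE UNIT CONFIGURATION at the term-pinned layer along `gOfRecord₁₃ θ`, sign inputs READ OFF ADMISSIBILITY**: in the run's window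
`]0, θ.γ]` up to `n ≥ kSel P + 1`, residual `0 ≤ β < 1`, `0 < L₀`, `0 ≤ O(1)B₃B₅`. [cite: Balaban1989LargeFieldI, (1.80) p.195, (1.89) p.198, (1.82) p.196, (1.24) p.182 (bookkeeping witness)] -/
theorem displays_tested_at_one_pinD189TH₁₃_of_admissible (hθ : θ.Admissible F N) (P : B12.RunParams) {n : ℕ} (hI : Step.InInterval θ.γ n (gOfRecord₁₃ F N θ P))
    (hkn : lam.kSel P + 1 ≤ n) (hβ0 : 0 ≤ (σT P).β) (hβ1 : (σT P).β < 1) (hL₀ : 0 < (σT P).L₀) (hB : 0 ≤ (σT P).O1 * (σT P).B₃ * (σT P).B₅) :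
    new189 ((lam.pinD189TH θ.ν θ.A₁ θ.τ9.M (gOfRecord₁₃ F N θ) σT sT NmT N₀T p₁).D189 P) ((1 : MSField (F.P P.K) (SU N)), fun _ _ => (0 : EuclideanSpace ℝ (Fin (N ^ 2 - 1)))) ∧
    (∀ i, ((lam.pinD189TH θ.ν θ.A₁ θ.τ9.M (gOfRecord₁₃ F N θ) σT sT NmT N₀T p₁).D189 P).h ≤ i →
      i ≤ ((lam.pinD189TH θ.ν θ.A₁ θ.τ9.M (gOfRecord₁₃ F N θ) σT sT NmT N₀T p₁).D189 P).k →
      ∀ q ∈ plaqsOf (dom ((lam.pinD189TH θ.ν θ.A₁ θ.τ9.M (gOfRecord₁₃ F N θ) σT sT NmT N₀T p₁).D189 P) i),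
      Ineq180 (((lam.pinD189TH θ.ν θ.A₁ θ.τ9.M (gOfRecord₁₃ F N θ) σT sT NmT N₀T p₁).D189 P).dev0 ((1 : MSField (F.P P.K) (SU N)), fun _ _ => (0 : EuclideanSpace ℝ (Fin (N ^ 2 - 1)))) q)
        (((lam.pinD189TH θ.ν θ.A₁ θ.τ9.M (gOfRecord₁₃ F N θ) σT sT NmT N₀T p₁).D189 P).ε ((lam.pinD189TH θ.ν θ.A₁ θ.τ9.M (gOfRecord₁₃ F N θ) σT sT NmT N₀T p₁).D189 P).k)
        ((lam.pinD189TH θ.ν θ.A₁ θ.τ9.M (gOfRecord₁₃ F N θ) σT sT NmT N₀T p₁).D189 P).η ((lam.pinD189TH θ.ν θ.A₁ θ.τ9.M (gOfRecord₁₃ F N θ) σT sT NmT N₀T p₁).D189 P).B₃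
        ((lam.pinD189TH θ.ν θ.A₁ θ.τ9.M (gOfRecord₁₃ F N θ) σT sT NmT N₀T p₁).D189 P).B₅ ((lam.pinD189TH θ.ν θ.A₁ θ.τ9.M (gOfRecord₁₃ F N θ) σT sT NmT N₀T p₁).D189 P).M
        ((lam.pinD189TH θ.ν θ.A₁ θ.τ9.M (gOfRecord₁₃ F N θ) σT sT NmT N₀T p₁).D189 P).δ
        (((lam.pinD189TH θ.ν θ.A₁ θ.τ9.M (gOfRecord₁₃ F N θ) σT sT NmT N₀T p₁).D189 P).dist q)
        ((lam.pinD189TH θ.ν θ.A₁ θ.τ9.M (gOfRecord₁₃ F N θ) σT sT NmT N₀T p₁).D189 P).O1) ∧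
    chiPP ((lam.pinD189TH θ.ν θ.A₁ θ.τ9.M (gOfRecord₁₃ F N θ) σT sT NmT N₀T p₁).D189 P) ((1 : MSField (F.P P.K) (SU N)), fun _ _ => (0 : EuclideanSpace ℝ (Fin (N ^ 2 - 1)))) :=
  have hs := signs_of_admissible₁₃ hθ
  displays_tested_at_one_pinD189TH lam (gOfRecord₁₃ F N θ) σT sT NmT N₀T p₁ hs.2.1 hs.1 hs.2.2.1 hs.2.2.2 P hI hkn hβ0 hβ1 hL₀ hB

end Admissible13

end B15Claim189PinsOfHistory

end Literature.MathematicalPhysics.QuantumFieldTheory.Balaban1983to89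

end
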